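import Summits.ABC.ABC.Theses.RibetTakahashiSplit
import Summits.ABC.ABC.Theorems.RibetTakahashiSplitWeightedSzpiroBoundAbc
import Literature.NumberTheory.EllipticCurves.SzpiroLocalDataProofs
import Literature.NumberTheory.EllipticCurves.SzpiroOfAbcProofs
import Literature.NumberTheory.EllipticCurves.SzpiroFreyProofs
import Literature.NumberTheory.EllipticCurves.SzpiroBGEquivalenceProofs
import Literature.NumberTheory.DiophantineGeometry.MinimalDiscriminantSmulProofs
import Literature.NumberTheory.DiophantineGeometry.MinimalDiscriminantFiniteProofs
import Literature.NumberTheory.DiophantineGeometry.MinimalDiscriminantProofs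
import Literature.NumberTheory.Sieve.DivisorBound
import Literature.NumberTheory.DiophantineGeometry.StrongHall

/-!
# Disproof of `ThinWeightedSzpiro` (crux stmt-ABC-17927, route ABC/RibetTakahashiSplit, r3″) — findings

Standing adversary file (refuter seat `refuter-cdisprove-stmt-ABC-17927-0`, cycle 1, 2026-08-17).
Sorry-free, `lean check` rc 0, 0 warnings; axioms `propext`, `Classical.choice`, `Quot.sound`.

**The crux.** `∃ θ > 0 ∀ ε > 0 ∀ K ∃ C ∀ W₀ : WeierstrassCurve ℤ`, elliptic over `ℚ`, minimal at every
prime, semistable away from `2` (`p² ∤ N` for odd `p`), θ-THIN (`T ≤ K · N^θ`):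
`max (|Δ(W₀)|, |c₄(W₀)|³) ≤ C · (N · T)^{6+ε}`, `N = conductorNorm`, `T = ∏_{p ∣ N, p² ∤ N} ord_p Δ_min`.
Readback of the elaborated term (W.lean, rc 0): all objects are the Mathlib/H21 definitions (Ogg-formula
conductor via Tate's algorithm, `Ideal.absNorm` of `finprod`s, `IsMinimal` over `O_v`); `^ θ`, `^ (6+ε)`
are `Real.rpow` on casts of naturals; no junk operator bites an ELLIPTIC `W₀` (`N ≥ 1`, `|Δ_min| ≥ 1`,
`T ≥ 1` — `WeightedSzpiroBound.one_le_tamWeight`, landed); for `K ≤ 0` the class is empty (vacuous,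
harmless); quantifier order `∃θ ∀ε ∀K ∃C` as in the informal text (θ frozen, C may depend on K).

## Findings (section numbers = sections of this file)

0. **Why it resists — machine-checked.** `WeightedSzpiroBound → ThinWeightedSzpiro` (restriction,
   `thin_of_weightedSzpiroBound`) and `ABC → ThinWeightedSzpiro` (`thin_of_abc`, through the landed
   `WeightedSzpiroBound.iff_abc`), hence `¬ ThinWeightedSzpiro → ¬ ABC` (`not_abc_of_not_thin`): there is
   NO refutation of r3″ short of a disproof of abc. `ThinAt θ` (the body at class exponent `θ`) is
   ANTITONE in `θ` (`thinAt_antitone`): the crux is `ThinAt θ` for all small `θ > 0`; `0 < θ` is exactly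
   what keeps the class infinite. The converse direction r3″ → ABC would need θ-thinness of (almost)
   all Frey curves at EVERY `θ > 0`, i.e. r2 ∧ r4 (in print only `θ > 8/3`, Pasten Thm 1.10, resp.
   `θ > 11/2`, Cor 16.2): the same-ε wording stmt-ABC-17736 died by this bootstrap at `ε = 6`
   (Collapse.lean); the frozen-θ wording does not collapse — checked again. §0b GAP LEMMA
   (`thinAt_selfImprove`, machine-checked; = `thinAt_gap` of the crux-attack seat
   refuter-rattack-stmt-ABC-17927-0, W.lean 05:49Z, re-proved here to be importable from this file): under
   `ThinAt θ` every θ-thin curve is δ-thin for EVERY `δ > 0` (`T ≤ A_η|Δ_min|^η ≤ A_η H^η`,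
   self-improving) — r3″ contains r2 ∧ r4 restricted to its own class and predicts an empty band
   `N^δ ≪ T ≤ K N^θ`; nothing bootstraps to the non-thin curves.
1. **`IsElliptic` is load-bearing** (any `θ`): `thinWeightedSzpiro_false_without_isElliptic` (nodal cubics
   `y² = (x−k)²(x+2k)`: `Δ = 0`, `c₄ = 144k²`, junk `N = T = 1`, thin with `K = 1`).
2. **Minimality is load-bearing** (any `θ`): `thinWeightedSzpiro_false_without_minimality`
   (`y² = x³ − k⁴x ≅ y² = x³ − x`: `N ∣ 64`, `T ≤ 6 ≤ 6N^θ`, `Δ = 64k¹²`). Any proof must control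
   `max(|Δ|,|c₄|³)` through the MINIMAL discriminant (`minimalDiscriminantNorm_eq_natAbs_holds`), not the
   model. (1–2 are the parent crux's items, Cruxes/WeightedSzpiroBound/Disproof.lean §§1–2, re-proved
   with the class condition.)
3. **NOT load-bearing for truth**: "semistable away from 2" (the statement without it follows from
   `GeneralizedSzpiroConjectureBG`, hence from `ABC`: `withoutSemistability_of_abc`) and the CLASS
   CONDITION itself (without it the statement is r3′ verbatim: `withoutThinness_iff_weightedSzpiroBound`,
   `withoutThinness_iff_abc`). The first is a mechanism hypothesis (Ribet–Takahashi needs multiplicative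
   primes); the second is the route's regime split — information for provers: a proof of r3″ that never
   uses `T ≤ K N^θ` proves ABC.
4. **Tightness — the exponent `6` is sharp INSIDE every thin class** (new): for every `κ < 6`,
   `¬ ThinWeightedSzpiroExp κ` (`thinWeightedSzpiroExp_false_of_lt_six`; the crux is
   `∀ ε > 0, ThinWeightedSzpiroExp (6+ε)` with the SAME θ, `thinExp_of_thin`). The parent's witnesses
   (`1 + (2ⁿ−1) = 2ⁿ`, Szpiro ratio → 6) are useless here — their thinness for small `θ` would need
   `rad(2ⁿ−1) ≥ τ(2ⁿ−1)^{1/θ}`, an abc-type radical bound; likewise the Danilov–Lucas family of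
   ideator 2's note B3. Witnesses with CERTIFIED thinness: the global minimal Frey models
   `testModel p m = freyIntModel 1 (p^{2m})` of `1 + p^{2m} = p^{2m} + 1`, `p` odd prime → ∞, `m = m(κ)`:
   `16 ∤ abc` (`p^{2m} ≡ 1 mod 8`), `|c₄|³ ≥ p^{12m}`, `N ∣ 2¹⁰ rad` so `N ≤ 2¹¹ p^{2m+1}`, `p ∣ N`, and
   `T ≤ τ(|Δ_min|) ≤ C_η p^{8mη}` (divisor bound), so the family is θ-thin for EVERY `θ > 0` and
   `(NT)^κ ≤ C p^{κ(2m+1+θ)}` loses to `p^{12m}` once `m(6−κ) > κ`. So weight + thinness buy at most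
   `N^{o(1)}`: r3″ is exponent-sharp from below in every thin class and abc-hard from above.
5. **`ε = 0` on the thin class** (`ThinWeightedSzpiroExp 6`): OPEN here. Ideator 2's B3 (Danilov–Lucas
   family, `v_5(2t−1)` lifting) refutes the UNRESTRICTED weighted `ε = 0` statement modulo routine
   formalisation, but for r3″ it needs those curves to be θ-thin for every θ, i.e.
   `∏ v_q(L_n-type numbers) ≤ K rad^θ` — expected, unprovable (abc-type). Not pursued.
6. **The picked line `Sketch` (idea thin-strong-hall-transfer, Lines/Sketch.lean).** Its ℕ normal form
   `ThinStrongHall` (`∃θ ∀ε ∀K ∃C`, `x³ − y² = z ≠ 0`, `1728 ∣ z`, `Prim23`, `p ≥ 5 ∧ p ∣ x ⇒ p ∤ z`,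
   `wt5 z ≤ K rad5 z^θ ⇒ max(|z|,|x|³) ≤ C (rad5 z · wt5 z)^{6+ε}`) is NOT cheaper-than-abc wrong: it
   follows from abc for every θ with the class condition unused — MACHINE-CHECKED in §6
   (`thinStrongHallBody_of_strongHall`, `thinStrongHallBody_of_abc`: descaling to a primitive solution of
   B–G 12.5.2 with factor `g ∣ 72`, then the tree's `StrongHallConjecture` / `strongHall_of_abcLe`;
   the lead's worker reached the same calibration independently — `thinStrongHall_of_strongHall`,
   evidence StubBulk.lean 08:03Z — so both seats agree: `stub_cusp`/`stub_bulk` are abc-true and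
   crux-sized, no disprover target among the ACTIVE stubs short of ¬abc).
   The first paper computation (kept for the record): apply abc to `(x³/G, y²/G, z/G)`, `G = gcd(x³,y²) = 2^{min(3a,2c)} 3^{min(3b,2d)}`
   (`a = v₂x, c = v₂y, b = v₃x, d = v₃y`; the prime-to-6 parts are coprime by the `p ≥ 5` hypothesis):
   `M := max(|x|³,y²,|z|) ≤ C_ε · S · 6^{3+3ε} (M^{5/6} rad5 z)^{1+ε}` with the {2,3}-slack
   `S = G / (2^{a+c} 3^{b+d})`. Given `1728 ∣ z`, `Prim23` caps the slack: 2-adically the three cases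
   `3a < 2c` (then `a ≤ 7`), `3a > 2c` (then `c ≤ 10`), `3a = 2c = 6t` (then `t ≤ 3`) give `S₂ ≤ 2³`;
   3-adically `b ≤ 5`, `d ≤ 8`, `t ≤ 2` give `S₃ ≤ 3²`; so `S ≤ 72` and
   `M ≤ C'_ε rad5(z)^{6(1+ε)/(1−5ε)}`. Equivalently: every admissible `(x, y)` descales at 2, 3 (by
   `d ∣ 2³3²`) to a PRIMITIVE solution in the sense of B–G 12.5.2, so `ThinStrongHall`, its cusp and its
   bulk halves are consequences of `Literature.NumberTheory.DiophantineGeometry.StrongHallConjecture`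
   (B–G 12.5.3), which the tree PROVES from abc (`strongHall_of_abcLe`). Verdict for the lead: the split
   is honest, the research stubs `stub_cusp`/`stub_bulk` are abc-strength restricted statements (kernel
   on squarefree `z`: weak Hall, open), and `Prim23` IS load-bearing — without it already the axis
   `(x, y) = (12·4ʲ, 0)`, `z = 1728·64ʲ` (`rad5 = wt5 = 1`) kills every `C`
   (`thinStrongHall_false_without_prim23`, §6 of this file, over verbatim copies of `rad5`/`wt5`; to be
   re-targeted at the line's Defs file when it lands — re-arm target). The provable stubs
   `stub_localData` / `stub_weights` / `stub_transfer` (re-derived on paper here: `f₂ ≤ 8` gives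
   `768 = 2⁸·3`; `wt5 z ≤ T` because the prime-to-6 primes of `Δ` are multiplicative with
   `ord_p Δ_min = v_p Δ(W₀)`; `K < 0` is the empty class) have meanwhile LANDED (p147685, p147744,
   p147670): the line is reduced BY NAME to the two research stubs. TARGETS (§6b, elementary,
   machine-checked): the natural strengthening of `stub_cusp` to any exponent `κ < 6` is FALSE inside
   every thin class (`cuspBodyExp_false_of_lt_six`: Frey points `(16(b²+b+1), 32(b−1)(2b+1)(b+2))`,
   `b = p^m`, certified thin) — the cusp stub has no exponent slack either; `stub_bulk`'s analogue
   would need certified-thin BULK points (`|x|³ < |z|`) and is left open (the Frey points all lie in the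
   cusp, `freyCurve_cusp`).
7. **Literature / negatives checked.** `ledger negatives --problem ABC`: 2 entries (BelyiSqueeze,
   GlobalQuasiLogDerivative), none touches r3″; the misstated predecessor stmt-ABC-17736 was restated,
   not indexed. Barrier catalogue read: `HallExponentSharp(Narrow)` (Danilov/Elkies: the `1/2` in Hall,
   i.e. the `2` in `|x| ≪ rad(z)^{2+ε}`, cannot be raised — consistent with §4's "6 is sharp", and its
   audit note records Hall's `∃ C > 0` form as OPEN, matching §5), `SzpiroEpsilonCannotBeDropped*`
   (Masser; does not transfer to the weighted statement, parent §4), `EpsilonCannotBeDropped`. Remote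
   literature search was DEGRADED this cycle (local searchd connection reset, Semantic Scholar 429,
   OpenAlex budget exhausted, arXiv/zbMATH 0 hits on 'Szpiro Tamagawa' variants; galaxy substring
   'Szpiro ratio': 3 irrelevant rows); the LOCAL hybrid index (5.26 M chunks) answered at 08:50Z:
   'Szpiro conjecture Tamagawa numbers component groups conductor discriminant bound' returns only the
   textbook treatments (B–G 2006 pp. 418–437 = §12.5, Silverman AEC VIII.11 pp. 219–225, ATAEC IV,
   Evertse–Győry 2015, Baker–Wüstholz 2007, Dokchitser² 2010) — nothing on Szpiro restricted to a
   bounded- or thin-weight class. Relied otherwise on the route's recorded searches (Pasten arXiv:1705.09251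
   Thm 1.10 / 1.12 / Cor 16.2: the only unconditional thinness results, at `θ > 8/3` on abc triples,
   `θ > 11/2` in general) and the parent disproof's §7; remote cascade to be re-run on re-arm.
8. **Compute.** No new farm job this cycle (an `∃ C` statement is not refutable by data, and two
   censuses are already attached to this item / its parent): the crux-attack seat's Frey-model census
   (jobs j023185, j023241: 204 abc hits with `c ≤ 2·10⁴` + 6 record triples, extended to `c ≤ 2·10⁵`)
   has `max log H / log(N·T) = 5.951 < 6` and an EMPTY thin slice `τ = log T/log N ≤ 0.25` at that
   height; the parent disproof's j006098/j006099 (13-smooth pairs `≤ 10⁸`; `ellmoddegree` mechanism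
   falsifier) found weighted ratios `≤ 5.95` on all champions. Consistent with §4 (ratio → 6 from below
   only along `m → ∞`) and with the prediction of the route's cheapest falsifier (a).

## For provers / planners
* Nothing here weakens the crux. Items 1–2: hypotheses every proof must touch; item 3: the ones it may
  ignore (and what ignoring the class condition would mean); item 4: no slack in the exponent even on
  the thinnest families; item 6: the line's normal form is sound and exactly abc-strength.
* Negative lemmas proposed to the tree (Theorems/ThinWeightedSzpiro/Negative/): `LoadBearing.lean`
  (§§1–2) and `ExponentSixSharp.lean` (§4); this file remains the index.
-/

set_option linter.dupNamespace false

namespace Summit.ABC.ABC.Cruxes.ThinWeightedSzpiro.Disproof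

open WeierstrassCurve IsDedekindDomain
open Summit.ABC.ABC.Theses.RibetTakahashiSplit
open Summit.ABC.ABC.Theorems
open Literature.NumberTheory.EllipticCurves

/-! ## 0. Position: the crux is a restriction of `WeightedSzpiroBound ↔ ABC` -/

/-- The thin-class crux at class exponent `θ` (the body of `ThinWeightedSzpiro` with `θ` free). -/
def ThinAt (θ : ℝ) : Prop :=
  ∀ ε : ℝ, 0 < ε → ∀ K : ℝ, ∃ C : ℝ, ∀ W₀ : WeierstrassCurve ℤ, (W₀.baseChange ℚ).IsElliptic →
    (∀ v : HeightOneSpectrum ℤ, (W₀.baseChange ℚ).IsMinimalAt v) →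
    (∀ p : ℕ, p.Prime → p ≠ 2 → ¬ p ^ 2 ∣ (W₀.baseChange ℚ).conductorNorm ℤ) →
    ((∏ p ∈ ((W₀.baseChange ℚ).conductorNorm ℤ).primeFactors with
        ¬ p ^ 2 ∣ (W₀.baseChange ℚ).conductorNorm ℤ,
        ((W₀.baseChange ℚ).minimalDiscriminantNorm ℤ).factorization p : ℕ) : ℝ) ≤
      K * (((W₀.baseChange ℚ).conductorNorm ℤ : ℕ) : ℝ) ^ θ →
    ((max |W₀.Δ| (|W₀.c₄| ^ 3) : ℤ) : ℝ) ≤ C * ((((W₀.baseChange ℚ).conductorNorm ℤ : ℕ) : ℝ) *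
      ((∏ p ∈ ((W₀.baseChange ℚ).conductorNorm ℤ).primeFactors with
        ¬ p ^ 2 ∣ (W₀.baseChange ℚ).conductorNorm ℤ,
        ((W₀.baseChange ℚ).minimalDiscriminantNorm ℤ).factorization p : ℕ) : ℝ)) ^ (6 + ε)

/-- The crux is `∃ θ > 0, ThinAt θ` (definitional). [folklore] -/
theorem thinWeightedSzpiro_iff : ThinWeightedSzpiro ↔ ∃ θ : ℝ, 0 < θ ∧ ThinAt θ := Iff.rfl

/-- `ThinAt` is ANTITONE in the class exponent: a larger `θ` is a larger class, a stronger claim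
(uses `N ≥ 1`, so `N^θ ≤ N^{θ'}` for `θ ≤ θ'`, and `K ≥ 0` w.l.o.g. since `T ≥ 0`). Hence the
crux is equivalent to `ThinAt θ` for all sufficiently small `θ > 0`, and `0 < θ` is exactly what
keeps the class infinite (for `θ < 0` the class `T ≤ K N^θ`, `T ≥ 1`, has bounded conductor).
[folklore] -/
theorem thinAt_antitone {θ θ' : ℝ} (hθ : θ ≤ θ') (h : ThinAt θ') : ThinAt θ := by
  intro ε hε K
  obtain ⟨C, hC⟩ := h ε hε (max K 0)
  refine ⟨C, fun W₀ hE hmin hss hthin ↦ hC W₀ hE hmin hss (hthin.trans ?_)⟩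
  haveI := hE
  have hN1 : (1 : ℝ) ≤ (((W₀.baseChange ℚ).conductorNorm ℤ : ℕ) : ℝ) := by
    exact_mod_cast conductorNorm_pos_holds (W₀.baseChange ℚ)
  calc K * (((W₀.baseChange ℚ).conductorNorm ℤ : ℕ) : ℝ) ^ θ
      ≤ max K 0 * (((W₀.baseChange ℚ).conductorNorm ℤ : ℕ) : ℝ) ^ θ :=
        mul_le_mul_of_nonneg_right (le_max_left _ _) (Real.rpow_nonneg (by positivity) _)
    _ ≤ max K 0 * (((W₀.baseChange ℚ).conductorNorm ℤ : ℕ) : ℝ) ^ θ' :=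
        mul_le_mul_of_nonneg_left (Real.rpow_le_rpow_of_exponent_le hN1 hθ) (le_max_right _ _)

/-- Degenerate constants: for `K ≤ 0` the θ-class is EMPTY (`T ≥ 1 > 0 ≥ K N^θ`), so the crux's inner
statement holds there with any `C` — harmless vacuity, no junk (= `thinAt_vacuous_of_neg` of the crux-attack
seat, extended to `K = 0`). [folklore] -/
theorem thin_class_empty_of_nonpos {θ K : ℝ} (hK : K ≤ 0) (W₀ : WeierstrassCurve ℤ)
    (hE : (W₀.baseChange ℚ).IsElliptic) :
    ¬ ((∏ p ∈ ((W₀.baseChange ℚ).conductorNorm ℤ).primeFactors with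
        ¬ p ^ 2 ∣ (W₀.baseChange ℚ).conductorNorm ℤ,
        ((W₀.baseChange ℚ).minimalDiscriminantNorm ℤ).factorization p : ℕ) : ℝ) ≤
      K * (((W₀.baseChange ℚ).conductorNorm ℤ : ℕ) : ℝ) ^ θ := by
  haveI := hE
  have hT : (1 : ℝ) ≤ ((∏ p ∈ ((W₀.baseChange ℚ).conductorNorm ℤ).primeFactors with
      ¬ p ^ 2 ∣ (W₀.baseChange ℚ).conductorNorm ℤ,
      ((W₀.baseChange ℚ).minimalDiscriminantNorm ℤ).factorization p : ℕ) : ℝ) := by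
    exact_mod_cast WeightedSzpiroBound.one_le_tamWeight (W₀.baseChange ℚ)
  have hN : (0 : ℝ) ≤ (((W₀.baseChange ℚ).conductorNorm ℤ : ℕ) : ℝ) ^ θ := by positivity
  intro h
  have hKN : K * (((W₀.baseChange ℚ).conductorNorm ℤ : ℕ) : ℝ) ^ θ ≤ 0 := mul_nonpos_of_nonpos_of_nonneg hK hN
  linarith

/-- `WeightedSzpiroBound → ThinAt θ` for every `θ` (drop the thinness hypothesis). [folklore] -/
theorem thinAt_of_weightedSzpiroBound (h : WeightedSzpiroBound) (θ : ℝ) : ThinAt θ := by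
  intro ε hε _
  obtain ⟨C, hC⟩ := h ε hε
  exact ⟨C, fun W₀ hE hmin hss _ ↦ hC W₀ hE hmin hss⟩

/-- r3′ ⟹ r3″: `WeightedSzpiroBound → ThinWeightedSzpiro` (restriction, `θ := 1`). [folklore] -/
theorem thin_of_weightedSzpiroBound (h : WeightedSzpiroBound) : ThinWeightedSzpiro :=
  ⟨1, one_pos, thinAt_of_weightedSzpiroBound h 1⟩

/-- `ABC → ThinWeightedSzpiro` (through the landed `WeightedSzpiroBound.iff_abc`, p77854). [folklore] -/
theorem thin_of_abc (h : _root_.ABC) : ThinWeightedSzpiro :=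
  thin_of_weightedSzpiroBound (WeightedSzpiroBound.iff_abc.mpr h)

/-- **Why the crux resists at truth level**: a refutation of r3″ is a disproof of the abc conjecture.
[folklore] -/
theorem not_abc_of_not_thin (h : ¬ ThinWeightedSzpiro) : ¬ _root_.ABC := fun hA ↦ h (thin_of_abc hA)

/-- … and a refutation of r3″ refutes r3′ = `WeightedSzpiroBound` (⟺ ABC ⟺ B–G 12.5.11). [folklore] -/
theorem not_weightedSzpiroBound_of_not_thin (h : ¬ ThinWeightedSzpiro) : ¬ WeightedSzpiroBound :=
  fun hW ↦ h (thin_of_weightedSzpiroBound hW)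

/-! ### 0b. The gap lemma: under r3″(θ), θ-thin curves are `o(1)`-thin

If `ThinAt θ` holds then every curve of the θ-class `T ≤ K N^θ` satisfies `T ≤ K' N^δ` for EVERY
`δ > 0` (`K' = K'(θ, K, δ)`): `T ≤ A_η |Δ_min|^η ≤ A_η H^η ≤ A_η C^η (N T)^{7η}` (absorption lemma
`WeightedSzpiroBound.prod_factorization_le_rpow`, `|Δ_min| = |Δ(W₀)| ≤ H` for the minimal model, r3″ at
`ε = 1`), a self-improving inequality in `T`. So r3″(θ) contains r2 ∧ r4 RESTRICTED to its own class,
and the route's `closes` needs r2, r4 at the single level θ only; nothing is said about curves with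
`N^δ ≪ T ≤ K N^θ` other than that, under r3″, there are none (for each `K`, up to constants) — a
checkable prediction of the crux, not a collapse. -/

/-- **Gap lemma.** `ThinAt θ →` every θ-thin curve is δ-thin for every `δ > 0`, with a constant depending
on `(θ, K, δ)`. [folklore] -/
theorem thinAt_selfImprove {θ : ℝ} (h : ThinAt θ) {δ : ℝ} (hδ : 0 < δ) (K : ℝ) :
    ∃ K' : ℝ, ∀ W₀ : WeierstrassCurve ℤ, (W₀.baseChange ℚ).IsElliptic →
      (∀ v : HeightOneSpectrum ℤ, (W₀.baseChange ℚ).IsMinimalAt v) →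
      (∀ p : ℕ, p.Prime → p ≠ 2 → ¬ p ^ 2 ∣ (W₀.baseChange ℚ).conductorNorm ℤ) →
      ((∏ p ∈ ((W₀.baseChange ℚ).conductorNorm ℤ).primeFactors with
          ¬ p ^ 2 ∣ (W₀.baseChange ℚ).conductorNorm ℤ,
          ((W₀.baseChange ℚ).minimalDiscriminantNorm ℤ).factorization p : ℕ) : ℝ) ≤
        K * (((W₀.baseChange ℚ).conductorNorm ℤ : ℕ) : ℝ) ^ θ →
      ((∏ p ∈ ((W₀.baseChange ℚ).conductorNorm ℤ).primeFactors with
          ¬ p ^ 2 ∣ (W₀.baseChange ℚ).conductorNorm ℤ,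
          ((W₀.baseChange ℚ).minimalDiscriminantNorm ℤ).factorization p : ℕ) : ℝ) ≤
        K' * (((W₀.baseChange ℚ).conductorNorm ℤ : ℕ) : ℝ) ^ δ := by
  obtain ⟨C, hC⟩ := h 1 one_pos K
  set η : ℝ := δ / (7 * (1 + δ)) with hη
  have hη0 : 0 < η := by positivity
  have h7η : 7 * η = δ / (1 + δ) := by rw [hη]; field_simp
  have h17η : 1 - 7 * η = 1 / (1 + δ) := by rw [h7η]; field_simp; ring
  have hlt : 7 * η < 1 := by
    rw [h7η, div_lt_one (by linarith)]; linarith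
  obtain ⟨A, hA0, hA⟩ := WeightedSzpiroBound.prod_factorization_le_rpow hη0
  set C₀ : ℝ := max C 1 with hC₀
  have hC₀1 : 1 ≤ C₀ := le_max_right _ _
  refine ⟨(A * C₀ ^ η) ^ (1 + δ), fun W₀ hE hmin hss hthin ↦ ?_⟩
  haveI := hE
  have key := hC W₀ hE hmin hss hthin
  -- names
  set N : ℕ := (W₀.baseChange ℚ).conductorNorm ℤ with hNdef
  set D : ℕ := (W₀.baseChange ℚ).minimalDiscriminantNorm ℤ with hDdef
  set T : ℕ := ∏ p ∈ N.primeFactors with ¬ p ^ 2 ∣ N, D.factorization p with hTdef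
  set H : ℝ := ((max |W₀.Δ| (|W₀.c₄| ^ 3) : ℤ) : ℝ) with hHdef
  have hN1 : (1 : ℝ) ≤ N := by exact_mod_cast conductorNorm_pos_holds (W₀.baseChange ℚ)
  have hT1 : (1 : ℝ) ≤ T := by exact_mod_cast WeightedSzpiroBound.one_le_tamWeight (W₀.baseChange ℚ)
  have hN0 : (0 : ℝ) < N := by linarith
  have hT0 : (0 : ℝ) < T := by linarith
  have hD0 : 0 < D := minimalDiscriminantNorm_pos_holds _
  -- `D = |Δ(W₀)| ≤ H`
  have hΔ0 : W₀.Δ ≠ 0 := Δ_ne_zero_of_isElliptic_baseChange_int W₀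
  have hDH : (D : ℝ) ≤ H := by
    have h1 : D = W₀.Δ.natAbs := minimalDiscriminantNorm_eq_natAbs_holds W₀ hΔ0 hmin
    rw [hHdef, h1]
    have : ((W₀.Δ.natAbs : ℕ) : ℝ) = ((|W₀.Δ| : ℤ) : ℝ) := by rw [Nat.cast_natAbs]
    rw [this]
    exact_mod_cast le_max_left _ _
  -- `T ≤ A D^η ≤ A H^η ≤ A C₀^η (N T)^{7η}`
  have hTD : (T : ℝ) ≤ A * (D : ℝ) ^ η := by
    have := hA D hD0 (N.primeFactors.filter (fun p ↦ ¬ p ^ 2 ∣ N))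
      (fun p hp ↦ (Nat.mem_primeFactors.mp (Finset.mem_filter.mp hp).1).1)
    simpa only [hTdef] using this
  have hH0 : 0 ≤ H := le_trans (by positivity) hDH
  have hkey : H ≤ C₀ * ((N : ℝ) * T) ^ (7 : ℝ) := by
    have : H ≤ C * ((N : ℝ) * T) ^ ((6 : ℝ) + 1) := by simpa only [hHdef, hNdef, hTdef, hDdef] using key
    rw [show (6 : ℝ) + 1 = 7 by norm_num] at this
    exact this.trans (mul_le_mul_of_nonneg_right (le_max_left _ _) (by positivity))
  have hNT0 : (0 : ℝ) ≤ (N : ℝ) * T := by positivity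
  have hTself : (T : ℝ) ≤ (A * C₀ ^ η * (N : ℝ) ^ (7 * η)) * (T : ℝ) ^ (7 * η) := by
    calc (T : ℝ) ≤ A * (D : ℝ) ^ η := hTD
      _ ≤ A * H ^ η := mul_le_mul_of_nonneg_left (Real.rpow_le_rpow (by positivity) hDH hη0.le) hA0.le
      _ ≤ A * (C₀ * ((N : ℝ) * T) ^ (7 : ℝ)) ^ η :=
          mul_le_mul_of_nonneg_left (Real.rpow_le_rpow hH0 hkey hη0.le) hA0.le
      _ = (A * C₀ ^ η * (N : ℝ) ^ (7 * η)) * (T : ℝ) ^ (7 * η) := by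
          rw [Real.mul_rpow (by positivity) (by positivity), ← Real.rpow_mul hNT0,
            Real.mul_rpow hN0.le hT0.le]
          ring
  -- self-improvement
  have himp := TwoAdicEisensteinAnchor.SlackTransfer.le_rpow_of_le_mul_rpow hT0 hlt hTself
  have hbase : 0 ≤ A * C₀ ^ η := by positivity
  calc (T : ℝ) ≤ (A * C₀ ^ η * (N : ℝ) ^ (7 * η)) ^ (1 / (1 - 7 * η)) := himp
    _ = (A * C₀ ^ η) ^ (1 + δ) * (N : ℝ) ^ δ := by
        rw [h17η, one_div_one_div, Real.mul_rpow hbase (by positivity), ← Real.rpow_mul hN0.le, h7η]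
        congr 2
        field_simp

/-! ## 1. Load-bearing hypothesis: ellipticity (`Δ ≠ 0`)

Dropping `(W₀.baseChange ℚ).IsElliptic` makes the statement FALSE for EVERY `θ`: for a singular
integral equation every integral model is minimal, `N = 1`, `T = 1` (junk values), so the class
condition reads `1 ≤ K` and the bound `|c₄|³ ≤ C`, while the nodal cubics
`y² = (x − k)²(x + 2k)` have `c₄ = 144 k²` (parent crux disproof §1, re-proved with the weight). -/

/-- The crux with the hypothesis `(W₀.baseChange ℚ).IsElliptic` removed (everything else verbatim). -/
def ThinWeightedSzpiroWithoutIsElliptic : Prop :=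
  ∃ θ : ℝ, 0 < θ ∧ ∀ ε : ℝ, 0 < ε → ∀ K : ℝ, ∃ C : ℝ, ∀ W₀ : WeierstrassCurve ℤ,
    (∀ v : HeightOneSpectrum ℤ, (W₀.baseChange ℚ).IsMinimalAt v) →
    (∀ p : ℕ, p.Prime → p ≠ 2 → ¬ p ^ 2 ∣ (W₀.baseChange ℚ).conductorNorm ℤ) →
    ((∏ p ∈ ((W₀.baseChange ℚ).conductorNorm ℤ).primeFactors with
        ¬ p ^ 2 ∣ (W₀.baseChange ℚ).conductorNorm ℤ,
        ((W₀.baseChange ℚ).minimalDiscriminantNorm ℤ).factorization p : ℕ) : ℝ) ≤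
      K * (((W₀.baseChange ℚ).conductorNorm ℤ : ℕ) : ℝ) ^ θ →
    ((max |W₀.Δ| (|W₀.c₄| ^ 3) : ℤ) : ℝ) ≤ C * ((((W₀.baseChange ℚ).conductorNorm ℤ : ℕ) : ℝ) *
      ((∏ p ∈ ((W₀.baseChange ℚ).conductorNorm ℤ).primeFactors with
        ¬ p ^ 2 ∣ (W₀.baseChange ℚ).conductorNorm ℤ,
        ((W₀.baseChange ℚ).minimalDiscriminantNorm ℤ).factorization p : ℕ) : ℝ)) ^ (6 + ε)

/-- Sanity: the crux is its elliptic restriction. [folklore] -/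
theorem thin_of_withoutIsElliptic (h : ThinWeightedSzpiroWithoutIsElliptic) : ThinWeightedSzpiro := by
  obtain ⟨θ, hθ, h⟩ := h
  exact ⟨θ, hθ, fun ε hε K ↦ (h ε hε K).imp fun _ hC W₀ _ hmin hss hthin ↦ hC W₀ hmin hss hthin⟩

/-- The nodal cubic `y² = x³ − 3k²x + 2k³ = (x − k)²(x + 2k)` over `ℤ`. -/
def nodalModel (k : ℤ) : WeierstrassCurve ℤ := ⟨0, 0, 0, -3 * k ^ 2, 2 * k ^ 3⟩

/-- `Δ = 0` for the nodal cubic. [folklore] -/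
theorem nodalModel_Δ (k : ℤ) : (nodalModel k).Δ = 0 := by
  simp only [nodalModel, WeierstrassCurve.Δ, WeierstrassCurve.b₂, WeierstrassCurve.b₄,
    WeierstrassCurve.b₆, WeierstrassCurve.b₈]
  ring

/-- `c₄ = 144 k²` for the nodal cubic. [folklore] -/
theorem nodalModel_c₄ (k : ℤ) : (nodalModel k).c₄ = 144 * k ^ 2 := by
  simp only [nodalModel, WeierstrassCurve.c₄, WeierstrassCurve.b₂, WeierstrassCurve.b₄]
  ring

section Singular

variable {A : Type*} [CommRing A] [IsDedekindDomain A] {K : Type*} [Field K]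
  [Algebra A K] [IsFractionRing A K]

/-- Junk value: for a singular `W` (`Δ = 0`) every exponent `ord_v (Δ_min)` is `0`. [folklore] -/
theorem ordMinimalDiscriminant_eq_zero_of_Δ_eq_zero (W : WeierstrassCurve K) (hW : W.Δ = 0)
    (v : HeightOneSpectrum A) : W.ordMinimalDiscriminant v = 0 := by
  have h0 : (((W.baseChange (v.adicCompletion K)).minimal (v.adicCompletionIntegers K)).integralModel
      (v.adicCompletionIntegers K)).Δ = 0 := by
    apply FaithfulSMul.algebraMap_injective (v.adicCompletionIntegers K) (v.adicCompletion K)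
    rw [integralModel_Δ_eq, map_zero, minimal, variableChange_Δ, baseChange, map_Δ, hW, map_zero,
      mul_zero]
  change (IsDiscreteValuationRing.addVal _ ((((W.baseChange (v.adicCompletion K)).minimal
    (v.adicCompletionIntegers K)).integralModel (v.adicCompletionIntegers K)).Δ)).toNat = 0
  rw [h0, IsDiscreteValuationRing.addVal_zero, ENat.toNat_top]

/-- Junk value: for a singular `W` every conductor exponent is `0`. [folklore] -/
theorem conductorExponent_eq_zero_of_Δ_eq_zero (W : WeierstrassCurve K) (hW : W.Δ = 0)
    (v : HeightOneSpectrum A) : W.conductorExponent v = 0 := by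
  have h1 := (W.kodairaSymbolAt v).numComponents_pos
  unfold conductorExponent numComponentsAt
  rw [ordMinimalDiscriminant_eq_zero_of_Δ_eq_zero W hW v]
  omega

/-- Junk value: the conductor ideal of a singular `W` is `1 = ⊤`. [folklore] -/
theorem conductor_eq_one_of_Δ_eq_zero (W : WeierstrassCurve K) (hW : W.Δ = 0) :
    W.conductor A = 1 := by
  unfold WeierstrassCurve.conductor
  simp only [conductorExponent_eq_zero_of_Δ_eq_zero W hW, pow_zero, finprod_one]

/-- Junk value: the conductor `N` of a singular `W / ℚ` is `1`. [folklore] -/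
theorem conductorNorm_eq_one_of_Δ_eq_zero (W : WeierstrassCurve ℚ) (hW : W.Δ = 0) :
    W.conductorNorm ℤ = 1 := by
  unfold conductorNorm
  rw [conductor_eq_one_of_Δ_eq_zero W hW, Ideal.one_eq_top, Ideal.absNorm_top]

/-- A singular integral equation over `ℤ` is minimal at every prime. [folklore] -/
theorem isMinimalAt_baseChange_int_of_Δ_eq_zero (W₀ : WeierstrassCurve ℤ) (hΔ : W₀.Δ = 0)
    (v : HeightOneSpectrum ℤ) : (W₀.baseChange ℚ).IsMinimalAt v := by
  rw [IsMinimalAt,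
    isMinimal_iff_of_le_one_iff (valued_le_one_iff_mem_range_adicCompletionIntegers v)]
  refine ⟨isIntegralAt_baseChange_int v W₀, fun C _ ↦ ?_⟩
  have h0 : ((W₀.baseChange ℚ).baseChange (v.adicCompletion ℚ)).Δ = 0 := by
    rw [baseChange, map_Δ, baseChange_int_Δ, hΔ, Int.cast_zero, map_zero]
  rw [variableChange_Δ, h0, mul_zero]

end Singular

/-- **Any proof of the crux must use ellipticity**: the crux with `IsElliptic` dropped is false,
whatever the class exponent `θ`. Witness: `nodalModel k` (`Δ = 0`, `c₄ = 144k²`, junk `N = T = 1`,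
θ-thin with `K = 1`), at `ε = 1`, `k = ⌈C⌉₊ + 1`. [folklore] -/
theorem thinWeightedSzpiro_false_without_isElliptic : ¬ ThinWeightedSzpiroWithoutIsElliptic := by
  rintro ⟨θ, -, h⟩
  obtain ⟨C, hC⟩ := h 1 one_pos 1
  set k : ℕ := ⌈C⌉₊ + 1 with hk
  have hkC : C < k := by
    have := Nat.le_ceil C
    push_cast [hk]
    linarith
  have hk1 : (1 : ℝ) ≤ k := by exact_mod_cast Nat.succ_le_succ (Nat.zero_le _)
  have hΔ : (nodalModel k).Δ = 0 := nodalModel_Δ k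
  have hΔ' : ((nodalModel k).baseChange ℚ).Δ = 0 := by rw [baseChange_int_Δ, hΔ, Int.cast_zero]
  have hN : ((nodalModel k).baseChange ℚ).conductorNorm ℤ = 1 :=
    conductorNorm_eq_one_of_Δ_eq_zero _ hΔ'
  have key := hC (nodalModel k) (isMinimalAt_baseChange_int_of_Δ_eq_zero _ hΔ) (by
    intro p hp _ hdvd
    have h1 : p ^ 2 ≤ 1 := Nat.le_of_dvd one_pos (hN ▸ hdvd)
    have h2 := hp.two_le
    nlinarith)
  rw [hN, hΔ, nodalModel_c₄] at key
  simp only [Nat.primeFactors_one, Finset.filter_empty, Finset.prod_empty, Nat.cast_one, mul_one,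
    Real.one_rpow, le_refl, forall_const] at key
  push_cast at key
  have hx : (k : ℝ) ≤ 144 * (k : ℝ) ^ 2 := by nlinarith
  have hy : 144 * (k : ℝ) ^ 2 ≤ (144 * (k : ℝ) ^ 2) ^ 3 := le_self_pow₀ (by nlinarith) (by norm_num)
  have hz : (144 * (k : ℝ) ^ 2) ^ 3 ≤ max |(0 : ℝ)| (|144 * (k : ℝ) ^ 2| ^ 3) :=
    le_max_of_le_right (by rw [abs_of_nonneg (by positivity)])
  linarith


/-! ## 2. Load-bearing hypothesis: minimality of the integral model at every prime

Dropping `∀ v, (W₀.baseChange ℚ).IsMinimalAt v` makes the statement FALSE for EVERY `θ`: `N` and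
`T` are isomorphism invariants of `E / ℚ`, so the rescalings `y² = x³ − k⁴ x` of `y² = x³ − x`
(`N ∣ 64`, `T ≤ 6`, hence θ-thin with `K = 6` for every `θ ≥ 0`) stay in the class while
`Δ = 64 k¹²` is unbounded (parent crux disproof §2, re-proved with the class condition). So any
proof must route `max(|Δ(W₀)|, |c₄(W₀)|³)` through the MINIMAL discriminant
(`minimalDiscriminantNorm_eq_natAbs_holds`), never through the model. -/

/-- The crux with the minimality hypothesis removed (everything else verbatim). -/
def ThinWeightedSzpiroWithoutMinimality : Prop :=
  ∃ θ : ℝ, 0 < θ ∧ ∀ ε : ℝ, 0 < ε → ∀ K : ℝ, ∃ C : ℝ, ∀ W₀ : WeierstrassCurve ℤ,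
    (W₀.baseChange ℚ).IsElliptic →
    (∀ p : ℕ, p.Prime → p ≠ 2 → ¬ p ^ 2 ∣ (W₀.baseChange ℚ).conductorNorm ℤ) →
    ((∏ p ∈ ((W₀.baseChange ℚ).conductorNorm ℤ).primeFactors with
        ¬ p ^ 2 ∣ (W₀.baseChange ℚ).conductorNorm ℤ,
        ((W₀.baseChange ℚ).minimalDiscriminantNorm ℤ).factorization p : ℕ) : ℝ) ≤
      K * (((W₀.baseChange ℚ).conductorNorm ℤ : ℕ) : ℝ) ^ θ →
    ((max |W₀.Δ| (|W₀.c₄| ^ 3) : ℤ) : ℝ) ≤ C * ((((W₀.baseChange ℚ).conductorNorm ℤ : ℕ) : ℝ) *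
      ((∏ p ∈ ((W₀.baseChange ℚ).conductorNorm ℤ).primeFactors with
        ¬ p ^ 2 ∣ (W₀.baseChange ℚ).conductorNorm ℤ,
        ((W₀.baseChange ℚ).minimalDiscriminantNorm ℤ).factorization p : ℕ) : ℝ)) ^ (6 + ε)

/-- Sanity: the crux is the restriction to global minimal models. [folklore] -/
theorem thin_of_withoutMinimality (h : ThinWeightedSzpiroWithoutMinimality) : ThinWeightedSzpiro := by
  obtain ⟨θ, hθ, h⟩ := h
  exact ⟨θ, hθ, fun ε hε K ↦ (h ε hε K).imp fun _ hC W₀ hE _ hss hthin ↦ hC W₀ hE hss hthin⟩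

/-- The global minimal model `y² = x³ − x` (Cremona 32a2; `Δ = 64`, `c₄ = 48`). -/
def baseModel : WeierstrassCurve ℤ := ⟨0, 0, 0, -1, 0⟩

/-- The rescaled, non-minimal models `y² = x³ − k⁴ x` of the same curve (`k ≠ 0`). -/
def rescaledModel (k : ℤ) : WeierstrassCurve ℤ := ⟨0, 0, 0, -k ^ 4, 0⟩

/-- `Δ (y² = x³ − x) = 64`. [folklore] -/
theorem baseModel_Δ : baseModel.Δ = 64 := by
  simp only [baseModel, WeierstrassCurve.Δ, WeierstrassCurve.b₂, WeierstrassCurve.b₄,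
    WeierstrassCurve.b₆, WeierstrassCurve.b₈]
  norm_num

/-- `Δ (y² = x³ − k⁴x) = 64 k¹²`. [folklore] -/
theorem rescaledModel_Δ (k : ℤ) : (rescaledModel k).Δ = 64 * k ^ 12 := by
  simp only [rescaledModel, WeierstrassCurve.Δ, WeierstrassCurve.b₂, WeierstrassCurve.b₄,
    WeierstrassCurve.b₆, WeierstrassCurve.b₈]
  ring

/-- Over `ℚ`, `y² = x³ − k⁴x` is the change of variables `u = k⁻¹` of `y² = x³ − x`. [folklore] -/
theorem rescaledModel_baseChange_eq_smul (k : ℤ) (hk : k ≠ 0) :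
    (rescaledModel k).baseChange ℚ =
      (⟨(Units.mk0 (k : ℚ) (by exact_mod_cast hk))⁻¹, 0, 0, 0⟩ : VariableChange ℚ) •
        baseModel.baseChange ℚ := by
  ext <;> simp [rescaledModel, baseModel, baseChange, variableChange_def]

/-- `y² = x³ − x` over `ℤ` is minimal at every prime (`ord_p (Δ) = ord_p (64) < 12`). [folklore] -/
theorem isMinimalAt_baseModel (v : HeightOneSpectrum ℤ) : (baseModel.baseChange ℚ).IsMinimalAt v := by
  refine isMinimalAt_baseChange_int_of_not_pow_dvd_Δ fun h ↦ ?_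
  rw [baseModel_Δ] at h
  have hp := (Rat.HeightOneSpectrum.prime_natGenerator v).two_le
  have h64 : ((Rat.HeightOneSpectrum.natGenerator v : ℤ)) ^ 12 ≤ 64 := Int.le_of_dvd (by norm_num) h
  have h4 : (2 : ℤ) ^ 12 ≤ ((Rat.HeightOneSpectrum.natGenerator v : ℤ)) ^ 12 :=
    pow_le_pow_left₀ (by norm_num) (by exact_mod_cast hp) 12
  linarith

/-- The minimal discriminant of the curve `y² = x³ − k⁴x` (`k ≠ 0`) is `|Δ_min| = 64`, whatever
the model. [folklore] -/
theorem minimalDiscriminantNorm_rescaledModel (k : ℤ) (hk : k ≠ 0) :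
    ((rescaledModel k).baseChange ℚ).minimalDiscriminantNorm ℤ = 64 := by
  unfold minimalDiscriminantNorm
  rw [rescaledModel_baseChange_eq_smul k hk, minimalDiscriminantIdeal_smul_holds]
  change (baseModel.baseChange ℚ).minimalDiscriminantNorm ℤ = 64
  rw [minimalDiscriminantNorm_eq_natAbs_holds baseModel (by rw [baseModel_Δ]; norm_num)
    isMinimalAt_baseModel, baseModel_Δ]
  rfl

/-- `y² = x³ − k⁴x` is an elliptic curve over `ℚ` for `k ≠ 0`. [folklore] -/
theorem isElliptic_rescaledModel (k : ℤ) (hk : k ≠ 0) : ((rescaledModel k).baseChange ℚ).IsElliptic := by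
  refine ⟨isUnit_iff_ne_zero.mpr ?_⟩
  rw [baseChange_int_Δ, rescaledModel_Δ]
  exact_mod_cast mul_ne_zero (by norm_num) (pow_ne_zero 12 hk)

/-- The conductor of `y² = x³ − k⁴x` divides `64` (`N ∣ |Δ_min| = 64`; in truth `N = 32`).
[folklore] -/
theorem conductorNorm_rescaledModel_dvd (k : ℤ) (hk : k ≠ 0) :
    ((rescaledModel k).baseChange ℚ).conductorNorm ℤ ∣ 64 := by
  haveI := isElliptic_rescaledModel k hk
  rw [← minimalDiscriminantNorm_rescaledModel k hk]
  exact conductorNorm_dvd_minimalDiscriminantNorm _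
    (finite_setOf_ordMinimalDiscriminant_ne_zero_holds (A := ℤ) _)

/-- The weight of `y² = x³ − k⁴x` is at most `6` (only `p = 2` can enter, with `ord_2 ∣Δ_min| ≤ 6`),
and its conductor is at most `64`. [folklore] -/
theorem weight_rescaledModel_le (k : ℤ) (hk : k ≠ 0) :
    (∏ p ∈ (((rescaledModel k).baseChange ℚ).conductorNorm ℤ).primeFactors with
        ¬ p ^ 2 ∣ ((rescaledModel k).baseChange ℚ).conductorNorm ℤ,
        (((rescaledModel k).baseChange ℚ).minimalDiscriminantNorm ℤ).factorization p) ≤ 6 := by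
  have hN := conductorNorm_rescaledModel_dvd k hk
  have hD := minimalDiscriminantNorm_rescaledModel k hk
  set N : ℕ := ((rescaledModel k).baseChange ℚ).conductorNorm ℤ with hNdef
  have hsub : N.primeFactors.filter (fun p ↦ ¬ p ^ 2 ∣ N) ⊆ {2} := by
    intro p hp
    rw [Finset.mem_filter, Nat.mem_primeFactors] at hp
    obtain ⟨⟨hprime, hpN, -⟩, -⟩ := hp
    have h1 : p ∣ 2 ^ 6 := hpN.trans hN
    rw [Finset.mem_singleton]
    exact (Nat.prime_dvd_prime_iff_eq hprime Nat.prime_two).mp (hprime.dvd_of_dvd_pow h1)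
  have hfac : ∀ p ∈ N.primeFactors.filter (fun p ↦ ¬ p ^ 2 ∣ N),
      (((rescaledModel k).baseChange ℚ).minimalDiscriminantNorm ℤ).factorization p ≤ 6 := by
    intro p hp
    rw [hD]
    have hp2 : p = 2 := Finset.mem_singleton.mp (hsub hp)
    subst hp2
    exact Nat.factorization_le_of_le_pow (by norm_num)
  have hT' := Finset.prod_le_pow_card _ _ 6 hfac
  have hcard : (N.primeFactors.filter (fun p ↦ ¬ p ^ 2 ∣ N)).card ≤ 1 :=
    (Finset.card_le_card hsub).trans (by simp)
  have h6 : 6 ^ (N.primeFactors.filter (fun p ↦ ¬ p ^ 2 ∣ N)).card ≤ 6 := by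
    calc 6 ^ (N.primeFactors.filter (fun p ↦ ¬ p ^ 2 ∣ N)).card ≤ 6 ^ 1 :=
          Nat.pow_le_pow_right (by norm_num) hcard
      _ = 6 := by norm_num
  exact hT'.trans h6

/-- **Any proof of the crux must use minimality of the model**: the crux with
`∀ v, IsMinimalAt v` dropped is false, whatever the class exponent `θ`. Witness: `rescaledModel k`
(`N ∣ 64`, `T ≤ 6 ≤ 6 N^θ`, `|Δ| = 64 k¹²`), at `ε = 1`, `K = 6`. [folklore] -/
theorem thinWeightedSzpiro_false_without_minimality : ¬ ThinWeightedSzpiroWithoutMinimality := by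
  rintro ⟨θ, hθ, h⟩
  obtain ⟨C, hC⟩ := h 1 one_pos 6
  -- the constant `B = 384 ^ 7` bounds `(N T) ^ 7`
  set B : ℝ := (384 : ℝ) ^ ((6 : ℝ) + 1) with hB
  have hB0 : 0 ≤ B := by positivity
  set k : ℕ := ⌈max C 0 * B⌉₊ + 1 with hk
  have hk0 : (k : ℤ) ≠ 0 := by
    have : k ≠ 0 := by omega
    exact_mod_cast this
  have hkC : max C 0 * B < k := by
    have := Nat.le_ceil (max C 0 * B)
    push_cast [hk]
    linarith
  have hk1 : (1 : ℝ) ≤ k := by exact_mod_cast Nat.succ_le_succ (Nat.zero_le _)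
  haveI hE := isElliptic_rescaledModel (k : ℤ) hk0
  have hN := conductorNorm_rescaledModel_dvd (k : ℤ) hk0
  have hT6' := weight_rescaledModel_le (k : ℤ) hk0
  -- semistability away from 2 holds: `N ∣ 64`
  have hss : ∀ p : ℕ, p.Prime → p ≠ 2 →
      ¬ p ^ 2 ∣ ((rescaledModel (k : ℤ)).baseChange ℚ).conductorNorm ℤ := by
    intro p hp hp2 hdvd
    have h1 : p ∣ 2 ^ 6 := (dvd_pow_self p two_ne_zero).trans (hdvd.trans hN)
    exact hp2 ((Nat.prime_dvd_prime_iff_eq hp Nat.prime_two).mp (hp.dvd_of_dvd_pow h1))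
  -- abbreviations
  set N : ℕ := ((rescaledModel (k : ℤ)).baseChange ℚ).conductorNorm ℤ with hNdef
  set T : ℕ := ∏ p ∈ N.primeFactors with ¬ p ^ 2 ∣ N,
    (((rescaledModel (k : ℤ)).baseChange ℚ).minimalDiscriminantNorm ℤ).factorization p with hTdef
  have hN64 : (N : ℝ) ≤ 64 := by exact_mod_cast Nat.le_of_dvd (by norm_num) hN
  have hN1 : (1 : ℝ) ≤ N := by exact_mod_cast conductorNorm_pos_holds ((rescaledModel (k : ℤ)).baseChange ℚ)
  have hT6 : (T : ℝ) ≤ 6 := by exact_mod_cast hT6'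
  -- the class condition `T ≤ 6 N^θ`
  have hthin : (T : ℝ) ≤ 6 * (N : ℝ) ^ θ := by
    have h1 : (1 : ℝ) ≤ (N : ℝ) ^ θ := Real.one_le_rpow hN1 hθ.le
    nlinarith
  have key := hC (rescaledModel (k : ℤ)) hE hss (by simpa only [hNdef, hTdef] using hthin)
  have hNT : (N : ℝ) * T ≤ 384 := by
    have hN0 : (0 : ℝ) ≤ N := by positivity
    have hT0 : (0 : ℝ) ≤ T := by positivity
    nlinarith
  have hNT0 : (0 : ℝ) ≤ (N : ℝ) * T := by positivity
  have hpow : ((N : ℝ) * T) ^ ((6 : ℝ) + 1) ≤ B := Real.rpow_le_rpow hNT0 hNT (by norm_num)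
  have hR : C * ((N : ℝ) * T) ^ ((6 : ℝ) + 1) ≤ max C 0 * B :=
    (mul_le_mul_of_nonneg_right (le_max_left C 0) (Real.rpow_nonneg hNT0 _)).trans
      (mul_le_mul_of_nonneg_left hpow (le_max_right C 0))
  -- lower bound `|Δ| = 64 k¹² ≥ k`
  have hL : (k : ℝ) ≤ ((max |(rescaledModel (k : ℤ)).Δ| (|(rescaledModel (k : ℤ)).c₄| ^ 3) : ℤ) : ℝ) := by
    rw [rescaledModel_Δ]
    push_cast
    refine le_max_of_le_left ?_
    rw [abs_of_nonneg (by positivity)]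
    have : (k : ℝ) ≤ (k : ℝ) ^ 12 := le_self_pow₀ hk1 (by norm_num)
    nlinarith
  have key' : ((max |(rescaledModel (k : ℤ)).Δ| (|(rescaledModel (k : ℤ)).c₄| ^ 3) : ℤ) : ℝ) ≤
      C * ((N : ℝ) * T) ^ ((6 : ℝ) + 1) := by
    simpa only [hNdef, hTdef] using key
  linarith


/-! ## 3. NOT load-bearing for truth: "semistable away from 2" and the class condition itself

Dropping `∀ p prime, p ≠ 2 → p² ∤ N` gives a statement that still follows from the generalized
Szpiro conjecture `GeneralizedSzpiroConjectureBG` (B–G 12.5.11 ⟺ abc), because `T ≥ 1`; dropping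
the class condition `T ≤ K N^θ` gives back r3′ = `WeightedSzpiroBound` (⟺ ABC, landed
`WeightedSzpiroBound.iff_abc`). So neither hypothesis can be shown necessary by a counterexample
short of `¬ ABC`: the first is a MECHANISM hypothesis (multiplicative primes for Ribet–Takahashi),
the second is the REGIME split of the route (it is what separates r3″ from ABC: r3″ → ABC would need
θ-thinness of (almost) all Frey curves at EVERY level `θ > 0`, i.e. r2 ∧ r4 — the same-ε wording
stmt-ABC-17736 died by exactly this bootstrap at the single level `ε = 6`, refuter Collapse.lean). -/

/-- The crux with the semistability-away-from-2 hypothesis removed (everything else verbatim). -/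
def ThinWeightedSzpiroWithoutSemistability : Prop :=
  ∃ θ : ℝ, 0 < θ ∧ ∀ ε : ℝ, 0 < ε → ∀ K : ℝ, ∃ C : ℝ, ∀ W₀ : WeierstrassCurve ℤ,
    (W₀.baseChange ℚ).IsElliptic →
    (∀ v : HeightOneSpectrum ℤ, (W₀.baseChange ℚ).IsMinimalAt v) →
    ((∏ p ∈ ((W₀.baseChange ℚ).conductorNorm ℤ).primeFactors with
        ¬ p ^ 2 ∣ (W₀.baseChange ℚ).conductorNorm ℤ,
        ((W₀.baseChange ℚ).minimalDiscriminantNorm ℤ).factorization p : ℕ) : ℝ) ≤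
      K * (((W₀.baseChange ℚ).conductorNorm ℤ : ℕ) : ℝ) ^ θ →
    ((max |W₀.Δ| (|W₀.c₄| ^ 3) : ℤ) : ℝ) ≤ C * ((((W₀.baseChange ℚ).conductorNorm ℤ : ℕ) : ℝ) *
      ((∏ p ∈ ((W₀.baseChange ℚ).conductorNorm ℤ).primeFactors with
        ¬ p ^ 2 ∣ (W₀.baseChange ℚ).conductorNorm ℤ,
        ((W₀.baseChange ℚ).minimalDiscriminantNorm ℤ).factorization p : ℕ) : ℝ)) ^ (6 + ε)

/-- Sanity: the strengthened statement implies the crux. [folklore] -/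
theorem thin_of_withoutSemistability (h : ThinWeightedSzpiroWithoutSemistability) : ThinWeightedSzpiro := by
  obtain ⟨θ, hθ, h⟩ := h
  exact ⟨θ, hθ, fun ε hε K ↦ (h ε hε K).imp fun _ hC W₀ hE hmin _ hthin ↦ hC W₀ hE hmin hthin⟩

/-- The strengthened statement (no semistability hypothesis, any `θ`) follows from
`GeneralizedSzpiroConjectureBG` (`T ≥ 1`, class condition unused). [folklore] -/
theorem withoutSemistability_of_generalizedSzpiroBG (h : GeneralizedSzpiroConjectureBG) :
    ThinWeightedSzpiroWithoutSemistability := by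
  refine ⟨1, one_pos, fun ε hε _ ↦ ?_⟩
  obtain ⟨C, hC⟩ := h ε hε
  refine ⟨max C 0, fun W₀ hE hmin _ ↦ ?_⟩
  haveI := hE
  have key := hC W₀ hE hmin
  have hN : (0 : ℝ) ≤ (((W₀.baseChange ℚ).conductorNorm ℤ : ℕ) : ℝ) := by positivity
  have hT : (1 : ℝ) ≤ ((∏ p ∈ ((W₀.baseChange ℚ).conductorNorm ℤ).primeFactors with
      ¬ p ^ 2 ∣ (W₀.baseChange ℚ).conductorNorm ℤ,
        ((W₀.baseChange ℚ).minimalDiscriminantNorm ℤ).factorization p : ℕ) : ℝ) := by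
    exact_mod_cast WeightedSzpiroBound.one_le_tamWeight (W₀.baseChange ℚ)
  calc _ ≤ C * (((W₀.baseChange ℚ).conductorNorm ℤ : ℕ) : ℝ) ^ (6 + ε) := key
    _ ≤ max C 0 * (((W₀.baseChange ℚ).conductorNorm ℤ : ℕ) : ℝ) ^ (6 + ε) :=
        mul_le_mul_of_nonneg_right (le_max_left _ _) (Real.rpow_nonneg hN _)
    _ ≤ _ := mul_le_mul_of_nonneg_left
        (Real.rpow_le_rpow hN (le_mul_of_one_le_right hN hT) (by linarith)) (le_max_right _ _)

/-- … hence from `ABC` itself (B–G Thm. 12.5.12, tree `abcLe_iff_generalizedSzpiroBG_holds`). [folklore] -/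
theorem withoutSemistability_of_abc (h : _root_.ABC) : ThinWeightedSzpiroWithoutSemistability := by
  refine withoutSemistability_of_generalizedSzpiroBG (abcLe_iff_generalizedSzpiroBG_holds.mp ?_)
  intro ε hε
  obtain ⟨C, -, hC⟩ := h ε hε
  exact ⟨C, fun a b c ht ↦ (hC a b c ht).le⟩

/-- The crux with the CLASS CONDITION removed is r3′ verbatim (the quantifiers `∃ θ > 0`, `∀ K`
become dummies): so "thinness" is the only thing standing between r3″ and `ABC`. [folklore] -/
theorem withoutThinness_iff_weightedSzpiroBound :
    (∃ θ : ℝ, 0 < θ ∧ ∀ ε : ℝ, 0 < ε → ∀ K : ℝ, ∃ C : ℝ, ∀ W₀ : WeierstrassCurve ℤ,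
      (W₀.baseChange ℚ).IsElliptic →
      (∀ v : HeightOneSpectrum ℤ, (W₀.baseChange ℚ).IsMinimalAt v) →
      (∀ p : ℕ, p.Prime → p ≠ 2 → ¬ p ^ 2 ∣ (W₀.baseChange ℚ).conductorNorm ℤ) →
      (0 : ℝ) ≤ K →
      ((max |W₀.Δ| (|W₀.c₄| ^ 3) : ℤ) : ℝ) ≤ C * ((((W₀.baseChange ℚ).conductorNorm ℤ : ℕ) : ℝ) *
        ((∏ p ∈ ((W₀.baseChange ℚ).conductorNorm ℤ).primeFactors with
          ¬ p ^ 2 ∣ (W₀.baseChange ℚ).conductorNorm ℤ,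
          ((W₀.baseChange ℚ).minimalDiscriminantNorm ℤ).factorization p : ℕ) : ℝ)) ^ (6 + ε)) ↔
    WeightedSzpiroBound := by
  constructor
  · rintro ⟨θ, -, h⟩ ε hε
    obtain ⟨C, hC⟩ := h ε hε 0
    exact ⟨C, fun W₀ hE hmin hss ↦ hC W₀ hE hmin hss le_rfl⟩
  · intro h
    refine ⟨1, one_pos, fun ε hε K ↦ ?_⟩
    obtain ⟨C, hC⟩ := h ε hε
    exact ⟨C, fun W₀ hE hmin hss _ ↦ hC W₀ hE hmin hss⟩

/-- … and r3′ is `ABC` (landed). [folklore] -/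
theorem withoutThinness_iff_abc :
    (∃ θ : ℝ, 0 < θ ∧ ∀ ε : ℝ, 0 < ε → ∀ K : ℝ, ∃ C : ℝ, ∀ W₀ : WeierstrassCurve ℤ,
      (W₀.baseChange ℚ).IsElliptic →
      (∀ v : HeightOneSpectrum ℤ, (W₀.baseChange ℚ).IsMinimalAt v) →
      (∀ p : ℕ, p.Prime → p ≠ 2 → ¬ p ^ 2 ∣ (W₀.baseChange ℚ).conductorNorm ℤ) →
      (0 : ℝ) ≤ K →
      ((max |W₀.Δ| (|W₀.c₄| ^ 3) : ℤ) : ℝ) ≤ C * ((((W₀.baseChange ℚ).conductorNorm ℤ : ℕ) : ℝ) *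
        ((∏ p ∈ ((W₀.baseChange ℚ).conductorNorm ℤ).primeFactors with
          ¬ p ^ 2 ∣ (W₀.baseChange ℚ).conductorNorm ℤ,
          ((W₀.baseChange ℚ).minimalDiscriminantNorm ℤ).factorization p : ℕ) : ℝ)) ^ (6 + ε)) ↔
    _root_.ABC :=
  withoutThinness_iff_weightedSzpiroBound.trans WeightedSzpiroBound.iff_abc


/-! ## 4. Tightness: the exponent `6` cannot be lowered INSIDE any thin class

`ThinWeightedSzpiroExp κ` is the crux with `(N·T)^{6+ε}` replaced by `(N·T)^κ` (quantifiers
`∃ θ > 0 ∀ K ∃ C`, so the crux gives `ThinWeightedSzpiroExp (6 + ε)` for every `ε > 0`). For every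
`κ < 6` it is FALSE. The parent's witnesses (minimal Frey models of `1 + (2ⁿ − 1) = 2ⁿ`, Szpiro ratio
`→ 6`) are useless here: their θ-thinness for small `θ` would need `rad(2ⁿ − 1) ≥ τ(…)^{1/θ}`, an
abc-type radical lower bound nobody can prove. New witnesses with CERTIFIED thinness: the global
minimal Frey models `W_{p,m} = freyIntModel 1 (p^{2m})` (B–G (12.17)) of `1 + p^{2m} = p^{2m} + 1`,
`p` an odd prime → ∞, `m = m(κ)` fixed: `|c₄|³ ≥ 16³ p^{12m}`, `N ∣ 2¹⁰ rad(p^{2m}(p^{2m}+1))` so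
`N ≤ 2¹¹ p^{2m+1}`, `p ∣ N` so `N ≥ p`, and `T ≤ τ(|Δ_min|) ≤ C_η p^{8mη}` (divisor bound): the family
is θ-thin for EVERY `θ > 0` (take `η = min(θ,1)/8m`), and `(N T)^κ ≤ C p^{κ(2m+1+θ)}` loses to
`p^{12m}` as soon as `m(6 − κ) > κ`. So the weight and the thinness together buy at most `N^{o(1)}`:
the crux is exponent-sharp from below inside every thin class, and abc-hard from above. -/

/-- The crux with exponent `κ` in place of `6 + ε`. -/
def ThinWeightedSzpiroExp (κ : ℝ) : Prop :=
  ∃ θ : ℝ, 0 < θ ∧ ∀ K : ℝ, ∃ C : ℝ, ∀ W₀ : WeierstrassCurve ℤ, (W₀.baseChange ℚ).IsElliptic →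
    (∀ v : HeightOneSpectrum ℤ, (W₀.baseChange ℚ).IsMinimalAt v) →
    (∀ p : ℕ, p.Prime → p ≠ 2 → ¬ p ^ 2 ∣ (W₀.baseChange ℚ).conductorNorm ℤ) →
    ((∏ p ∈ ((W₀.baseChange ℚ).conductorNorm ℤ).primeFactors with
        ¬ p ^ 2 ∣ (W₀.baseChange ℚ).conductorNorm ℤ,
        ((W₀.baseChange ℚ).minimalDiscriminantNorm ℤ).factorization p : ℕ) : ℝ) ≤
      K * (((W₀.baseChange ℚ).conductorNorm ℤ : ℕ) : ℝ) ^ θ →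
    ((max |W₀.Δ| (|W₀.c₄| ^ 3) : ℤ) : ℝ) ≤ C * ((((W₀.baseChange ℚ).conductorNorm ℤ : ℕ) : ℝ) *
      ((∏ p ∈ ((W₀.baseChange ℚ).conductorNorm ℤ).primeFactors with
        ¬ p ^ 2 ∣ (W₀.baseChange ℚ).conductorNorm ℤ,
        ((W₀.baseChange ℚ).minimalDiscriminantNorm ℤ).factorization p : ℕ) : ℝ)) ^ κ

/-- The crux gives `ThinWeightedSzpiroExp (6 + ε)` for every `ε > 0` (repackaging). [folklore] -/
theorem thinExp_of_thin (h : ThinWeightedSzpiro) {ε : ℝ} (hε : 0 < ε) :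
    ThinWeightedSzpiroExp (6 + ε) := by
  obtain ⟨θ, hθ, h⟩ := h
  exact ⟨θ, hθ, fun K ↦ h ε hε K⟩

/-- `ThinWeightedSzpiroExp` is MONOTONE in the exponent (`N·T ≥ 1`). [folklore] -/
theorem thinExp_mono {κ κ' : ℝ} (hκ : κ ≤ κ') (h : ThinWeightedSzpiroExp κ) : ThinWeightedSzpiroExp κ' := by
  obtain ⟨θ, hθ, h⟩ := h
  refine ⟨θ, hθ, fun K ↦ ?_⟩
  obtain ⟨C, hC⟩ := h K
  refine ⟨max C 0, fun W₀ hE hmin hss hthin ↦ ?_⟩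
  haveI := hE
  have key := hC W₀ hE hmin hss hthin
  have hN1 : (1 : ℝ) ≤ (((W₀.baseChange ℚ).conductorNorm ℤ : ℕ) : ℝ) := by
    exact_mod_cast conductorNorm_pos_holds (W₀.baseChange ℚ)
  have hT1 : (1 : ℝ) ≤ ((∏ p ∈ ((W₀.baseChange ℚ).conductorNorm ℤ).primeFactors with
      ¬ p ^ 2 ∣ (W₀.baseChange ℚ).conductorNorm ℤ,
      ((W₀.baseChange ℚ).minimalDiscriminantNorm ℤ).factorization p : ℕ) : ℝ) := by
    exact_mod_cast WeightedSzpiroBound.one_le_tamWeight (W₀.baseChange ℚ)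
  have hNT1 := one_le_mul_of_one_le_of_one_le hN1 hT1
  calc _ ≤ _ := key
    _ ≤ max C 0 * _ := mul_le_mul_of_nonneg_right (le_max_left _ _) (Real.rpow_nonneg (by positivity) _)
    _ ≤ _ := mul_le_mul_of_nonneg_left (Real.rpow_le_rpow_of_exponent_le hNT1 hκ) (le_max_right _ _)

/-- The `ε = 0` form (`ThinWeightedSzpiroExp 6`, §5: OPEN) implies the crux (same `θ`). [folklore] -/
theorem thin_of_thinExp_six (h : ThinWeightedSzpiroExp 6) : ThinWeightedSzpiro := by
  obtain ⟨θ, hθ, h6⟩ := h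
  refine ⟨θ, hθ, fun ε hε K ↦ ?_⟩
  obtain ⟨C, hC⟩ := h6 K
  refine ⟨max C 0, fun W₀ hE hmin hss hthin ↦ ?_⟩
  haveI := hE
  have key := hC W₀ hE hmin hss hthin
  have hN1 : (1 : ℝ) ≤ (((W₀.baseChange ℚ).conductorNorm ℤ : ℕ) : ℝ) := by
    exact_mod_cast conductorNorm_pos_holds (W₀.baseChange ℚ)
  have hT1 : (1 : ℝ) ≤ ((∏ p ∈ ((W₀.baseChange ℚ).conductorNorm ℤ).primeFactors with
      ¬ p ^ 2 ∣ (W₀.baseChange ℚ).conductorNorm ℤ,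
      ((W₀.baseChange ℚ).minimalDiscriminantNorm ℤ).factorization p : ℕ) : ℝ) := by
    exact_mod_cast WeightedSzpiroBound.one_le_tamWeight (W₀.baseChange ℚ)
  have hNT1 := one_le_mul_of_one_le_of_one_le hN1 hT1
  calc _ ≤ _ := key
    _ ≤ max C 0 * _ := mul_le_mul_of_nonneg_right (le_max_left _ _) (Real.rpow_nonneg (by positivity) _)
    _ ≤ _ := mul_le_mul_of_nonneg_left
        (Real.rpow_le_rpow_of_exponent_le hNT1 (by linarith : (6 : ℝ) ≤ 6 + ε)) (le_max_right _ _)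

section Tight

open Literature.NumberTheory.Sieve UniqueFactorizationMonoid

/-- `T ≤ τ(|Δ_min|)`: the weight is at most the number of divisors of the minimal discriminant
(`N ∣ |Δ_min|`, `v ≤ v + 1`). [folklore] -/
theorem weight_le_card_divisors (W : WeierstrassCurve ℚ) [W.IsElliptic] :
    ∏ p ∈ (W.conductorNorm ℤ).primeFactors with ¬ p ^ 2 ∣ W.conductorNorm ℤ,
        (W.minimalDiscriminantNorm ℤ).factorization p ≤ (W.minimalDiscriminantNorm ℤ).divisors.card := by
  have hND : W.conductorNorm ℤ ∣ W.minimalDiscriminantNorm ℤ :=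
    conductorNorm_dvd_minimalDiscriminantNorm W (finite_setOf_ordMinimalDiscriminant_ne_zero_holds (A := ℤ) W)
  have hD0 : W.minimalDiscriminantNorm ℤ ≠ 0 := (minimalDiscriminantNorm_pos_holds W).ne'
  rw [Nat.card_divisors hD0]
  calc ∏ p ∈ (W.conductorNorm ℤ).primeFactors with ¬ p ^ 2 ∣ W.conductorNorm ℤ,
        (W.minimalDiscriminantNorm ℤ).factorization p
      ≤ ∏ p ∈ (W.conductorNorm ℤ).primeFactors with ¬ p ^ 2 ∣ W.conductorNorm ℤ,
        ((W.minimalDiscriminantNorm ℤ).factorization p + 1) :=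
          Finset.prod_le_prod (fun _ _ ↦ Nat.zero_le _) (fun _ _ ↦ Nat.le_succ _)
    _ ≤ ∏ p ∈ (W.minimalDiscriminantNorm ℤ).primeFactors, ((W.minimalDiscriminantNorm ℤ).factorization p + 1) := by
          refine Finset.prod_le_prod_of_subset_of_one_le' ?_ (fun _ _ _ ↦ Nat.le_add_left 1 _)
          intro p hp
          rw [Finset.mem_filter] at hp
          have hp' := Nat.mem_primeFactors.mp hp.1
          exact Nat.mem_primeFactors.mpr ⟨hp'.1, hp'.2.1.trans hND, hD0⟩

/-- The test curves: the B–G (12.17) models `W_{p,m} = freyIntModel 1 (p^{2m})`,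
`y² = x (x − 1) (x + p^{2m})`, of the abc triples `1 + p^{2m} = p^{2m} + 1`. -/
def testModel (p m : ℕ) : WeierstrassCurve ℤ := freyIntModel 1 ((p : ℤ) ^ (2 * m))

variable {p m : ℕ}

/-- `1 · p^{2m} · (1 + p^{2m})` is the cast of the natural number `p^{2m} (p^{2m} + 1)`. [folklore] -/
theorem testProd_eq (p m : ℕ) :
    (1 : ℤ) * (p : ℤ) ^ (2 * m) * (1 + (p : ℤ) ^ (2 * m)) = ((p ^ (2 * m) * (p ^ (2 * m) + 1) : ℕ) : ℤ) := by
  push_cast; ring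

/-- `p^{2m}(p^{2m}+1) ≠ 0` for a prime `p`. [folklore] -/
theorem testProd_ne_zero (hp : p.Prime) : (1 : ℤ) * (p : ℤ) ^ (2 * m) * (1 + (p : ℤ) ^ (2 * m)) ≠ 0 := by
  rw [testProd_eq]
  have : 0 < p ^ (2 * m) := pow_pos hp.pos _
  positivity

/-- For an odd prime `p`, `16 ∤ p^{2m}(p^{2m}+1)` (`p^{2m} ≡ 1 (mod 8)`, so the product is `≡ 2 (mod 4)`
up to the odd factor): the abc triple `1 + p^{2m} = p^{2m}+1` falls under B–G 12.5.10, first case. [folklore] -/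
theorem not_sixteen_dvd_testProd (hp : p.Prime) (hp2 : p ≠ 2) (m : ℕ) :
    ¬ (16 : ℤ) ∣ (1 : ℤ) * (p : ℤ) ^ (2 * m) * (1 + (p : ℤ) ^ (2 * m)) := by
  rw [testProd_eq]
  intro h
  have h' : 16 ∣ p ^ (2 * m) * (p ^ (2 * m) + 1) := by exact_mod_cast h
  have hodd : Odd (p ^ m) := (hp.odd_of_ne_two hp2).pow
  obtain ⟨r, hr⟩ := hodd
  have hsq : p ^ (2 * m) = (p ^ m) ^ 2 := by rw [pow_mul']
  have hcop : Nat.Coprime 16 (p ^ (2 * m)) := by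
    have h2 : Nat.Coprime 2 p := (Nat.coprime_primes Nat.prime_two hp).mpr (Ne.symm hp2)
    have := Nat.Coprime.pow 4 (2 * m) h2
    norm_num at this
    exact this
  have h1 : 16 ∣ p ^ (2 * m) + 1 := hcop.dvd_of_dvd_mul_left h'
  have h2 : p ^ (2 * m) + 1 = 4 * (r ^ 2 + r) + 2 := by rw [hsq, hr]; ring
  rw [h2] at h1
  generalize r ^ 2 + r = s at h1
  omega

/-- `c₄ (W_{p,m}) = 16 (1 + p^{2m} + p^{4m})`. [folklore] -/
theorem testModel_c₄ (p m : ℕ) : (testModel p m).c₄ = 16 * (1 + (p : ℤ) ^ (2 * m) + (p : ℤ) ^ (4 * m)) := by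
  unfold testModel; rw [freyIntModel_c₄]; ring

/-- `Δ (W_{p,m}) = 16 (p^{2m}(p^{2m}+1))²`. [folklore] -/
theorem testModel_Δ (p m : ℕ) :
    (testModel p m).Δ = (((16 * (p ^ (2 * m) * (p ^ (2 * m) + 1)) ^ 2 : ℕ)) : ℤ) := by
  unfold testModel; rw [freyIntModel_Δ]; push_cast; ring

/-- `W_{p,m}` is an elliptic curve. [folklore] -/
theorem isElliptic_testModel (hp : p.Prime) (m : ℕ) : ((testModel p m).baseChange ℚ).IsElliptic := by
  have h := isElliptic_freyIntModel (A := 1) (B := (p : ℤ) ^ (2 * m)) (by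
    have := testProd_ne_zero (m := m) hp; rwa [one_mul] at this ⊢)
  exact h

/-- `W_{p,m}` is minimal at every prime (B–G 12.5.10, first case: `16 ∤ abc`). [folklore] -/
theorem isMinimalAt_testModel (hp : p.Prime) (hp2 : p ≠ 2) (m : ℕ) (v : HeightOneSpectrum ℤ) :
    ((testModel p m).baseChange ℚ).IsMinimalAt v :=
  isMinimalAt_freyIntModel isCoprime_one_left (by simpa only [one_mul] using testProd_ne_zero (m := m) hp)
    (by simpa only [one_mul] using not_sixteen_dvd_testProd hp hp2 m) v

/-- `N (W_{p,m}) ∣ 2¹⁰ rad(p^{2m}(p^{2m}+1))`. [folklore] -/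
theorem conductorNorm_testModel_dvd (hp : p.Prime) (hp2 : p ≠ 2) (m : ℕ) :
    ((testModel p m).baseChange ℚ).conductorNorm ℤ ∣ 2 ^ 10 * radical (p ^ (2 * m) * (p ^ (2 * m) + 1)) := by
  have h := conductorNorm_freyIntModel_dvd (A := 1) (B := (p : ℤ) ^ (2 * m)) isCoprime_one_left
    (by simpa only [one_mul] using testProd_ne_zero (m := m) hp)
    (by simpa only [one_mul] using not_sixteen_dvd_testProd hp hp2 m)
  have hx : ((1 : ℤ) * (p : ℤ) ^ (2 * m) * (1 + (p : ℤ) ^ (2 * m))).natAbs = p ^ (2 * m) * (p ^ (2 * m) + 1) := by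
    rw [testProd_eq, Int.natAbs_natCast]
  unfold testModel; rwa [hx] at h

/-- `rad(p^{2m}(p^{2m}+1)) ≤ p (p^{2m} + 1)`. [folklore] -/
theorem radical_testProd_le (hp : p.Prime) (m : ℕ) :
    radical (p ^ (2 * m) * (p ^ (2 * m) + 1)) ≤ p * (p ^ (2 * m) + 1) := by
  have hk : p * (p ^ (2 * m) + 1) ≠ 0 := mul_ne_zero hp.ne_zero (Nat.succ_ne_zero _)
  apply Nat.le_of_dvd (Nat.pos_of_ne_zero hk)
  rw [Nat.radical_dvd_iff hk]
  intro q hq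
  rw [Nat.mem_primeFactors] at hq ⊢
  refine ⟨hq.1, ?_, hk⟩
  rcases (Nat.Prime.dvd_mul hq.1).mp hq.2.1 with h | h
  · exact dvd_mul_of_dvd_left (hq.1.dvd_of_dvd_pow h) _
  · exact dvd_mul_of_dvd_right h _

/-- `N (W_{p,m}) ≤ 2¹⁰ p (p^{2m} + 1)`. [folklore] -/
theorem conductorNorm_testModel_le (hp : p.Prime) (hp2 : p ≠ 2) (m : ℕ) :
    ((testModel p m).baseChange ℚ).conductorNorm ℤ ≤ 2 ^ 10 * (p * (p ^ (2 * m) + 1)) := by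
  have h1 := Nat.le_of_dvd (mul_pos (by positivity) (Nat.radical_pos _)) (conductorNorm_testModel_dvd hp hp2 m)
  exact h1.trans (Nat.mul_le_mul_left _ (radical_testProd_le hp m))

/-- `N (W_{p,m})` is squarefree away from `2`. [folklore] -/
theorem not_sq_dvd_conductorNorm_testModel (hp : p.Prime) (hp2 : p ≠ 2) (m : ℕ) {q : ℕ} (hq : q.Prime)
    (hq2 : q ≠ 2) : ¬ q ^ 2 ∣ ((testModel p m).baseChange ℚ).conductorNorm ℤ := by
  intro hdvd
  have hcop : Nat.Coprime (q ^ 2) (2 ^ 10) :=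
    Nat.Coprime.pow 2 10 ((Nat.coprime_primes hq Nat.prime_two).mpr hq2)
  have h1 : q ^ 2 ∣ radical (p ^ (2 * m) * (p ^ (2 * m) + 1)) :=
    hcop.dvd_of_dvd_mul_left (hdvd.trans (conductorNorm_testModel_dvd hp hp2 m))
  have hsq := squarefree_radical (a := p ^ (2 * m) * (p ^ (2 * m) + 1))
  rw [Nat.squarefree_iff_prime_squarefree] at hsq
  exact hsq q hq (by rwa [sq] at h1)

/-- `p ∣ N (W_{p,m})` for `m ≥ 1` (`p` is a bad prime). [folklore] -/
theorem dvd_conductorNorm_testModel (hp : p.Prime) (hp2 : p ≠ 2) (hm : 1 ≤ m) :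
    p ∣ ((testModel p m).baseChange ℚ).conductorNorm ℤ := by
  haveI := isElliptic_testModel hp m
  refine dvd_conductorNorm_of_dvd_Δ (testModel p m) (Δ_ne_zero_of_isElliptic_baseChange_int _)
    (isMinimalAt_testModel hp hp2 m) hp ?_
  rw [testModel_Δ]
  have : p ∣ 16 * (p ^ (2 * m) * (p ^ (2 * m) + 1)) ^ 2 :=
    dvd_mul_of_dvd_right (dvd_pow (dvd_mul_of_dvd_left (dvd_pow_self p (by omega)) _) two_ne_zero) 16
  exact_mod_cast this

/-- `|Δ_min (W_{p,m})| = 16 (p^{2m}(p^{2m}+1))²`. [folklore] -/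
theorem minimalDiscriminantNorm_testModel (hp : p.Prime) (hp2 : p ≠ 2) (m : ℕ) :
    ((testModel p m).baseChange ℚ).minimalDiscriminantNorm ℤ = 16 * (p ^ (2 * m) * (p ^ (2 * m) + 1)) ^ 2 := by
  haveI := isElliptic_testModel hp m
  rw [minimalDiscriminantNorm_eq_natAbs_holds (testModel p m) (Δ_ne_zero_of_isElliptic_baseChange_int _)
    (isMinimalAt_testModel hp hp2 m), testModel_Δ, Int.natAbs_natCast]

/-- Real-number bookkeeping for `W_{p,m}` (`p` an odd prime, `m ≥ 1`, `X = p^{2m}`):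
`p ≤ N ≤ 2¹¹ p X`, `|Δ_min| ≤ 64 X⁴`, `max(|Δ|, |c₄|³) ≥ X⁶ = p^{12m}`. [folklore] -/
theorem testModel_real_bounds (hp : p.Prime) (hp2 : p ≠ 2) (hm : 1 ≤ m) :
    ((p : ℝ) ≤ ((((testModel p m).baseChange ℚ).conductorNorm ℤ : ℕ) : ℝ)) ∧
    (((((testModel p m).baseChange ℚ).conductorNorm ℤ : ℕ) : ℝ) ≤ 2 ^ 11 * (p : ℝ) * (p : ℝ) ^ (2 * m)) ∧
    (((((testModel p m).baseChange ℚ).minimalDiscriminantNorm ℤ : ℕ) : ℝ) ≤ 64 * ((p : ℝ) ^ (2 * m)) ^ 4) ∧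
    ((p : ℝ) ^ (12 * m) ≤ ((max |(testModel p m).Δ| (|(testModel p m).c₄| ^ 3) : ℤ) : ℝ)) := by
  haveI := isElliptic_testModel hp m
  have hP1 : (1 : ℝ) ≤ (p : ℝ) := by exact_mod_cast hp.one_lt.le
  have hP0 : (0 : ℝ) < (p : ℝ) := by linarith
  set X : ℝ := (p : ℝ) ^ (2 * m) with hX
  have hX1 : 1 ≤ X := one_le_pow₀ hP1
  have hX0 : 0 < X := by positivity
  refine ⟨?_, ?_, ?_, ?_⟩
  · exact_mod_cast Nat.le_of_dvd (conductorNorm_pos_holds _) (dvd_conductorNorm_testModel hp hp2 hm)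
  · have h1 : ((((testModel p m).baseChange ℚ).conductorNorm ℤ : ℕ) : ℝ) ≤
        ((2 ^ 10 * (p * (p ^ (2 * m) + 1)) : ℕ) : ℝ) := by
      exact_mod_cast conductorNorm_testModel_le hp hp2 m
    have h2 : (((2 ^ 10 * (p * (p ^ (2 * m) + 1)) : ℕ)) : ℝ) = 2 ^ 10 * (p : ℝ) * (X + 1) := by
      rw [hX]; push_cast; ring
    rw [h2] at h1
    nlinarith
  · have h1 : ((((testModel p m).baseChange ℚ).minimalDiscriminantNorm ℤ : ℕ) : ℝ) = 16 * (X * (X + 1)) ^ 2 := by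
      rw [minimalDiscriminantNorm_testModel hp hp2 m, hX]; push_cast; ring
    rw [h1]
    have h2 : X + 1 ≤ 2 * X := by linarith
    have h3 : (X * (X + 1)) ^ 2 ≤ (X * (2 * X)) ^ 2 :=
      pow_le_pow_left₀ (by positivity) (mul_le_mul_of_nonneg_left h2 hX0.le) 2
    nlinarith
  · have hc : ((testModel p m).c₄ : ℝ) = 16 * (1 + X + X ^ 2) := by
      rw [testModel_c₄, hX]; push_cast; ring
    have hc2 : X ^ 2 ≤ ((testModel p m).c₄ : ℝ) := by rw [hc]; nlinarith
    have hc0 : (0 : ℝ) ≤ ((testModel p m).c₄ : ℝ) := le_trans (by positivity) hc2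
    push_cast
    refine le_max_of_le_right ?_
    rw [abs_of_nonneg hc0]
    calc (p : ℝ) ^ (12 * m) = (X ^ 2) ^ 3 := by rw [hX, ← pow_mul, ← pow_mul]; ring_nf
      _ ≤ ((testModel p m).c₄ : ℝ) ^ 3 := pow_le_pow_left₀ (by positivity) hc2 3

set_option maxHeartbeats 400000 in
/-- **The exponent `6` is sharp inside every thin class**: for every `κ < 6`,
`ThinWeightedSzpiroExp κ` is false. Witnesses `W_{p,m}` (`m = m(κ)`, odd primes `p → ∞`),
certified θ-thin for every `θ > 0` by `p ∣ N` and the divisor bound. [folklore] -/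
theorem thinWeightedSzpiroExp_false_of_lt_six {κ : ℝ} (hκ : κ < 6) : ¬ ThinWeightedSzpiroExp κ := by
  rintro ⟨θ, hθ, hK⟩
  -- exponents
  set k : ℝ := max κ 0 with hk
  have hk0 : 0 ≤ k := le_max_right _ _
  have hk6 : k < 6 := max_lt hκ (by norm_num)
  set θ₁ : ℝ := min θ 1 with hθ₁
  have hθ₁0 : 0 < θ₁ := lt_min hθ one_pos
  have hθ₁1 : θ₁ ≤ 1 := min_le_right _ _
  have hθ₁θ : θ₁ ≤ θ := min_le_left _ _
  -- the parameter `m ≥ 1` with `m (6 − k) > k`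
  set m : ℕ := ⌈k / (6 - k)⌉₊ + 1 with hm
  have hm1 : 1 ≤ m := by omega
  have hmR : k / (6 - k) < m := by
    have := Nat.le_ceil (k / (6 - k))
    push_cast [hm]
    linarith
  have hmk : k < m * (6 - k) := by rwa [div_lt_iff₀ (by linarith)] at hmR
  have hmpos : (0 : ℝ) < m := by exact_mod_cast hm1
  have hm0 : (m : ℝ) ≠ 0 := hmpos.ne'
  -- divisor bound at `η = θ₁ / (8 m)`
  set η : ℝ := θ₁ / (8 * m) with hη
  have hη0 : 0 < η := by positivity
  have h8 : ((2 * m * 4 : ℕ) : ℝ) * η = θ₁ := by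
    rw [hη]; push_cast; field_simp; ring
  obtain ⟨Cη, hCη1, hτ⟩ := exists_card_divisors_le_mul_rpow hη0
  have hCη0 : 0 < Cη := by linarith
  -- the thinness constant and the adversary's constant
  set K : ℝ := Cη * (64 : ℝ) ^ η with hKdef
  have hK0 : 0 < K := by positivity
  obtain ⟨C, hC⟩ := hK K
  -- the exponent gap
  set e : ℝ := (2 * m + 1 + θ₁) * k with he
  have he0 : 0 ≤ e := by positivity
  set g : ℝ := 12 * m - e with hg
  have hg0 : 0 < g := by
    rw [hg, he]
    nlinarith
  -- the constant to beat and the prime `p`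
  set M : ℝ := max C 0 * ((2 : ℝ) ^ 11 * K) ^ k with hM
  have hM0 : 0 ≤ M := by positivity
  obtain ⟨p, hpge, hp⟩ := Nat.exists_infinite_primes (max 3 (⌈M ^ (1 / g)⌉₊ + 1))
  have hp3 : 3 ≤ p := le_of_max_le_left hpge
  have hp2 : p ≠ 2 := by omega
  -- the curve `W_{p,m}` and its real bounds
  obtain ⟨hNp, hNle, hDle, hL⟩ := testModel_real_bounds hp hp2 hm1
  haveI hE := isElliptic_testModel hp m
  have hmin := isMinimalAt_testModel hp hp2 m
  have hss : ∀ q : ℕ, q.Prime → q ≠ 2 → ¬ q ^ 2 ∣ ((testModel p m).baseChange ℚ).conductorNorm ℤ :=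
    fun q hq hq2 ↦ not_sq_dvd_conductorNorm_testModel hp hp2 m hq hq2
  have hT1 : (1 : ℝ) ≤ ((∏ q ∈ (((testModel p m).baseChange ℚ).conductorNorm ℤ).primeFactors with
      ¬ q ^ 2 ∣ ((testModel p m).baseChange ℚ).conductorNorm ℤ,
      (((testModel p m).baseChange ℚ).minimalDiscriminantNorm ℤ).factorization q : ℕ) : ℝ) := by
    exact_mod_cast WeightedSzpiroBound.one_le_tamWeight ((testModel p m).baseChange ℚ)
  have hTD : ((∏ q ∈ (((testModel p m).baseChange ℚ).conductorNorm ℤ).primeFactors with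
      ¬ q ^ 2 ∣ ((testModel p m).baseChange ℚ).conductorNorm ℤ,
      (((testModel p m).baseChange ℚ).minimalDiscriminantNorm ℤ).factorization q : ℕ) : ℝ) ≤
      ((((testModel p m).baseChange ℚ).minimalDiscriminantNorm ℤ).divisors.card : ℝ) := by
    exact_mod_cast weight_le_card_divisors ((testModel p m).baseChange ℚ)
  have hD0 : ((testModel p m).baseChange ℚ).minimalDiscriminantNorm ℤ ≠ 0 :=
    (minimalDiscriminantNorm_pos_holds _).ne'
  have hτD := hτ _ hD0
  -- abbreviations
  set P : ℝ := (p : ℝ) with hP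
  set N : ℕ := ((testModel p m).baseChange ℚ).conductorNorm ℤ with hNdef
  set D : ℕ := ((testModel p m).baseChange ℚ).minimalDiscriminantNorm ℤ with hDdef
  set T : ℕ := ∏ q ∈ N.primeFactors with ¬ q ^ 2 ∣ N, D.factorization q with hTdef
  set X : ℝ := P ^ (2 * m) with hX
  have hP1 : (1 : ℝ) < P := by rw [hP]; exact_mod_cast (by omega : 1 < p)
  have hP0 : (0 : ℝ) < P := by linarith
  have hX0 : (0 : ℝ) < X := by positivity
  have hN1 : (1 : ℝ) ≤ N := hP1.le.trans hNp
  have hPM : M < P ^ g := by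
    have h1 : M ^ (1 / g) < P := by
      have := Nat.le_ceil (M ^ (1 / g))
      have h2 : ((⌈M ^ (1 / g)⌉₊ + 1 : ℕ) : ℝ) ≤ P := by rw [hP]; exact_mod_cast le_of_max_le_right hpge
      push_cast at h2
      linarith
    have h2 : (M ^ (1 / g)) ^ g < P ^ g := Real.rpow_lt_rpow (Real.rpow_nonneg hM0 _) h1 hg0
    rwa [← Real.rpow_mul hM0, one_div_mul_cancel hg0.ne', Real.rpow_one] at h2
  -- `T ≤ Cη D^η ≤ K P^{θ₁}`
  have hTle : (T : ℝ) ≤ K * P ^ θ₁ := by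
    have h3 : (D : ℝ) ^ η ≤ (64 * X ^ (4 : ℕ)) ^ η := Real.rpow_le_rpow (by positivity) hDle hη0.le
    have h6 : (64 * X ^ (4 : ℕ)) ^ η = (64 : ℝ) ^ η * P ^ θ₁ := by
      rw [Real.mul_rpow (by norm_num) (by positivity), hX, ← pow_mul, ← Real.rpow_natCast P (2 * m * 4),
        ← Real.rpow_mul hP0.le, h8]
    calc (T : ℝ) ≤ Cη * (D : ℝ) ^ η := hTD.trans hτD
      _ ≤ Cη * (64 * X ^ (4 : ℕ)) ^ η := mul_le_mul_of_nonneg_left h3 hCη0.le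
      _ = K * P ^ θ₁ := by rw [h6, hKdef]; ring
  -- the class condition at level `θ`
  have hthin : (T : ℝ) ≤ K * (N : ℝ) ^ θ := by
    calc (T : ℝ) ≤ K * P ^ θ₁ := hTle
      _ ≤ K * (N : ℝ) ^ θ₁ := mul_le_mul_of_nonneg_left (Real.rpow_le_rpow hP0.le hNp hθ₁0.le) hK0.le
      _ ≤ K * (N : ℝ) ^ θ := mul_le_mul_of_nonneg_left (Real.rpow_le_rpow_of_exponent_le hN1 hθ₁θ) hK0.le
  have key := hC (testModel p m) hE hmin hss (by simpa only [hNdef, hTdef, hDdef] using hthin)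
  have key' : ((max |(testModel p m).Δ| (|(testModel p m).c₄| ^ 3) : ℤ) : ℝ) ≤ C * ((N : ℝ) * T) ^ κ := by
    simpa only [hNdef, hTdef, hDdef] using key
  -- `N T ≤ 2¹¹ K · P^{2m+1+θ₁}`
  have hNT1 : (1 : ℝ) ≤ (N : ℝ) * T := one_le_mul_of_one_le_of_one_le hN1 hT1
  have hPe : P ^ (2 * m) * P * P ^ θ₁ = P ^ (2 * m + 1 + θ₁) := by
    rw [Real.rpow_add hP0, Real.rpow_add hP0, Real.rpow_one, ← Real.rpow_natCast P (2 * m)]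
    push_cast; ring
  have hNT : (N : ℝ) * T ≤ 2 ^ 11 * K * P ^ (2 * m + 1 + θ₁) := by
    calc (N : ℝ) * T ≤ (2 ^ 11 * P * X) * (K * P ^ θ₁) :=
          mul_le_mul hNle hTle (by positivity) (by positivity)
      _ = 2 ^ 11 * K * (P ^ (2 * m) * P * P ^ θ₁) := by rw [hX]; ring
      _ = 2 ^ 11 * K * P ^ (2 * m + 1 + θ₁) := by rw [hPe]
  -- `(N T)^κ ≤ (2¹¹ K)^k P^e`
  have h2K : (0 : ℝ) ≤ 2 ^ 11 * K := by positivity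
  have hpow : ((N : ℝ) * T) ^ κ ≤ (2 ^ 11 * K) ^ k * P ^ e := by
    calc ((N : ℝ) * T) ^ κ ≤ ((N : ℝ) * T) ^ k :=
          Real.rpow_le_rpow_of_exponent_le hNT1 (le_max_left _ _)
      _ ≤ (2 ^ 11 * K * P ^ (2 * m + 1 + θ₁)) ^ k := Real.rpow_le_rpow (by positivity) hNT hk0
      _ = (2 ^ 11 * K) ^ k * (P ^ (2 * m + 1 + θ₁)) ^ k :=
          Real.mul_rpow h2K (Real.rpow_nonneg hP0.le _)
      _ = (2 ^ 11 * K) ^ k * P ^ e := by rw [← Real.rpow_mul hP0.le, he]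
  have hR : C * ((N : ℝ) * T) ^ κ ≤ M * P ^ e := by
    calc C * ((N : ℝ) * T) ^ κ ≤ max C 0 * ((N : ℝ) * T) ^ κ :=
          mul_le_mul_of_nonneg_right (le_max_left _ _) (Real.rpow_nonneg (by positivity) _)
      _ ≤ max C 0 * ((2 ^ 11 * K) ^ k * P ^ e) := mul_le_mul_of_nonneg_left hpow (le_max_right _ _)
      _ = M * P ^ e := by rw [hM]; ring
  -- `P^{12m} = P^g · P^e`, combine
  have hsplit : P ^ (12 * m) = P ^ g * P ^ e := by
    rw [← Real.rpow_natCast P (12 * m), ← Real.rpow_add hP0, hg]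
    push_cast; ring_nf
  have hPe0 : 0 < P ^ e := Real.rpow_pos_of_pos hP0 e
  have h1 : P ^ g * P ^ e ≤ M * P ^ e := by
    rw [← hsplit]
    exact hL.trans (key'.trans hR)
  have h3 : P ^ g ≤ M := le_of_mul_le_mul_right h1 hPe0
  linarith

/-- Corollary: no exponent below `6` works in the crux — thin class, weight and all. [folklore] -/
theorem not_exists_thinWeightedSzpiroExp_lt_six : ¬ ∃ κ : ℝ, κ < 6 ∧ ThinWeightedSzpiroExp κ :=
  fun ⟨_, hκ, h⟩ ↦ thinWeightedSzpiroExp_false_of_lt_six hκ h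

end Tight


/-! ## 6. The picked line `Sketch` (idea `thin-strong-hall-transfer`): `Prim23` is load-bearing

The line reduces the crux to the ℕ normal form `ThinStrongHall` over `rad5`/`wt5` (Lines/Sketch.lean
§0, not importable from a work file — the two definitions below are VERBATIM copies, to be replaced by
the reviewed `RibetTakahashiSplitThinWeightedSzpiroDefs` when it lands). WITH `Prim23` the normal form
follows from the strong Hall conjecture B–G 12.5.3 (`thinStrongHallBody_of_strongHall`, machine-checked:
descale to a primitive solution, `exists_primitive_descaling`; the descaling factor divides `72` by
`Prim23` + `1728 ∣ z`, `descaling_dvd_72`; `rad|z'| ≤ rad|z| ≤ 6·rad5 z`), hence from abc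
(`thinStrongHallBody_of_abc`, via the tree's `strongHall_of_abcLe`) — for EVERY `θ`, class condition
unused: the line is not cheaper-than-abc wrong, and its research stubs are honest abc-strength
restrictions. WITHOUT `Prim23` it is false for every `θ`, already on the `y = 0` axis:
`(x, y) = (12·4ʲ, 0)`, `z = 1728·64ʲ`, `rad5 z = wt5 z = 1` (`thinStrongHall_false_without_prim23`). -/

/-- Copy of `rad5` of Lines/Sketch.lean: radical of the prime-to-6 part, `∏_{p ≥ 5, p ∣ z} p`. -/
def rad5 (z : ℤ) : ℕ := ∏ p ∈ z.natAbs.primeFactors with 5 ≤ p, p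

/-- Copy of `wt5` of Lines/Sketch.lean: exponent weight of the prime-to-6 part, `∏_{p ≥ 5, p ∣ z} v_p(z)`. -/
def wt5 (z : ℤ) : ℕ := ∏ p ∈ z.natAbs.primeFactors with 5 ≤ p, z.natAbs.factorization p

section StrongHallTransfer

open UniqueFactorizationMonoid Literature.NumberTheory.DiophantineGeometry

/-- `wt5 z ≥ 1`. [folklore] -/
theorem one_le_wt5 (z : ℤ) : 1 ≤ wt5 z := by
  unfold wt5
  rw [Nat.one_le_iff_ne_zero, Finset.prod_ne_zero_iff]
  intro p hp
  rw [Finset.mem_filter] at hp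
  obtain ⟨hpp, hpd, hne⟩ := Nat.mem_primeFactors.mp hp.1
  exact (hpp.factorization_pos_of_dvd hne hpd).ne'

/-- `rad5 z ≥ 1`. [folklore] -/
theorem one_le_rad5 (z : ℤ) : 1 ≤ rad5 z := by
  unfold rad5
  rw [Nat.one_le_iff_ne_zero, Finset.prod_ne_zero_iff]
  intro p hp
  rw [Finset.mem_filter] at hp
  omega

/-- `rad |z| ≤ 6 · rad5 z`: the primes `< 5` contribute at most `2 · 3`. [folklore] -/
theorem radical_natAbs_le_six_mul_rad5 (z : ℤ) : radical z.natAbs ≤ 6 * rad5 z := by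
  rw [Nat.radical_eq_prod_primeFactors, ← Finset.prod_filter_mul_prod_filter_not z.natAbs.primeFactors (fun p ↦ 5 ≤ p)]
  rw [mul_comm]
  refine Nat.mul_le_mul ?_ le_rfl
  have hsub : z.natAbs.primeFactors.filter (fun p ↦ ¬ 5 ≤ p) ⊆ {2, 3} := by
    intro p hp
    rw [Finset.mem_filter] at hp
    have hpp := (Nat.mem_primeFactors.mp hp.1).1
    have h2 := hpp.two_le
    rw [Finset.mem_insert, Finset.mem_singleton]
    rcases (show p = 2 ∨ p = 3 ∨ p = 4 by omega) with h | h | h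
    · exact Or.inl h
    · exact Or.inr h
    · exfalso; rw [h] at hpp; exact (by decide : ¬ Nat.Prime 4) hpp
  calc ∏ p ∈ z.natAbs.primeFactors.filter (fun p ↦ ¬ 5 ≤ p), p ≤ ∏ p ∈ ({2, 3} : Finset ℕ), p :=
        Finset.prod_le_prod_of_subset_of_one_le' hsub (fun p hp _ ↦ by
          rw [Finset.mem_insert, Finset.mem_singleton] at hp; omega)
    _ = 6 := by decide

/-- `rad |z'| ≤ rad |z|` for `z' ∣ z ≠ 0`. [folklore] -/
theorem radical_natAbs_le_of_dvd {z' z : ℤ} (h : z' ∣ z) (hz : z ≠ 0) : radical z'.natAbs ≤ radical z.natAbs :=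
  Nat.le_of_dvd (Nat.radical_pos _) (radical_dvd_radical (Int.natAbs_dvd_natAbs.mpr h) (Int.natAbs_ne_zero.mpr hz))

/-- **Descaling to a primitive solution** (B–G 12.5.2): every solution of `x³ − y² = z ≠ 0` is
`(g² x', g³ y')` with `(x', y', x'³ − y'²)` primitive and `g ≥ 1`. [cite: BombieriGubler2006, 12.5.2] -/
theorem exists_primitive_descaling (x y : ℤ) (hz : x ^ 3 - y ^ 2 ≠ 0) :
    ∃ (g : ℕ) (x' y' : ℤ), 0 < g ∧ x = (g : ℤ) ^ 2 * x' ∧ y = (g : ℤ) ^ 3 * y' ∧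
      IsPrimitiveHallSolution x' y' (x' ^ 3 - y' ^ 2) := by
  set G : ℕ := Int.gcd (x ^ 3) (y ^ 2) with hG
  have hG0 : G ≠ 0 := by
    intro h0
    rw [hG, Int.gcd_eq_zero_iff] at h0
    apply hz; rw [h0.1, h0.2]; ring
  set g : ℕ := Nat.findGreatest (fun d ↦ d ^ 6 ∣ G) G with hg
  have hG1 : 1 ≤ G := Nat.one_le_iff_ne_zero.mpr hG0
  have hg1 : 1 ≤ g := Nat.le_findGreatest hG1 (by simp)
  have hgG : g ^ 6 ∣ G := Nat.findGreatest_spec (P := fun d ↦ d ^ 6 ∣ G) hG1 (by simp)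
  have hmax : ∀ k, g < k → ¬ k ^ 6 ∣ G := by
    intro k hk hdvd
    have hkG : k ≤ G := by
      have h1 : k ≤ k ^ 6 := Nat.le_self_pow (by norm_num) k
      exact h1.trans (Nat.le_of_dvd (by omega) hdvd)
    exact Nat.findGreatest_is_greatest hk hkG hdvd
  -- `g² ∣ x`, `g³ ∣ y`
  have hgx3 : ((g : ℤ) ^ 2) ^ 3 ∣ x ^ 3 := by
    have : ((g ^ 6 : ℕ) : ℤ) ∣ x ^ 3 := (Int.natCast_dvd_natCast.mpr hgG).trans (hG ▸ Int.gcd_dvd_left _ _)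
    rw [← pow_mul]; exact_mod_cast this
  have hgy2 : ((g : ℤ) ^ 3) ^ 2 ∣ y ^ 2 := by
    have : ((g ^ 6 : ℕ) : ℤ) ∣ y ^ 2 := (Int.natCast_dvd_natCast.mpr hgG).trans (hG ▸ Int.gcd_dvd_right _ _)
    rw [← pow_mul]; exact_mod_cast this
  obtain ⟨x', hx'⟩ := (Int.pow_dvd_pow_iff three_ne_zero).mp hgx3
  obtain ⟨y', hy'⟩ := (Int.pow_dvd_pow_iff two_ne_zero).mp hgy2
  refine ⟨g, x', y', hg1, hx', hy', rfl, ?_, ?_⟩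
  · -- `z' ≠ 0`
    intro h0
    apply hz
    rw [hx', hy']
    have : x' ^ 3 = y' ^ 2 := sub_eq_zero.mp h0
    ring_nf; rw [this]; ring
  · -- primitivity by maximality of `g`
    intro d hd
    have hgcd : Int.gcd (x ^ 3) (y ^ 2) = g ^ 6 * Int.gcd (x' ^ 3) (y' ^ 2) := by
      rw [hx', hy', show ((g : ℤ) ^ 2 * x') ^ 3 = (g : ℤ) ^ 6 * x' ^ 3 by ring,
        show ((g : ℤ) ^ 3 * y') ^ 2 = (g : ℤ) ^ 6 * y' ^ 2 by ring, Int.gcd_mul_left]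
      simp [Int.natAbs_pow]
    have hdG : (g * d) ^ 6 ∣ G := by
      rw [hG, hgcd, mul_pow]
      exact Nat.mul_dvd_mul_left _ hd
    rcases Nat.lt_or_ge 1 d with hlt | hle
    · exfalso
      exact hmax (g * d) (by nlinarith) hdG
    · interval_cases d
      · exfalso
        rw [zero_pow (by norm_num), zero_dvd_iff, Int.gcd_eq_zero_iff] at hd
        obtain ⟨h1, h2⟩ := hd
        have hx0 : x' = 0 := by
          rcases eq_or_ne x' 0 with h | h
          · exact h
          · exact absurd h1 (pow_ne_zero 3 h)
        have hy0 : y' = 0 := by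
          rcases eq_or_ne y' 0 with h | h
          · exact h
          · exact absurd h2 (pow_ne_zero 2 h)
        apply hz
        rw [hx', hy', hx0, hy0]; ring
      · rfl

/-- Under the line's side conditions (`1728 ∣ z`, `Prim23`, no prime `≥ 5` common to `x` and `z`) the
descaling factor `g` (`g² ∣ x`, `g³ ∣ y`) is a {2,3}-unit dividing `72 = 2³·3²`. [folklore] -/
theorem descaling_dvd_72 {x y : ℤ} {g : ℕ} (hg : 0 < g) (hgx : (g : ℤ) ^ 2 ∣ x) (hgy : (g : ℤ) ^ 3 ∣ y)
    (h1728 : (1728 : ℤ) ∣ x ^ 3 - y ^ 2)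
    (hprim : ¬ ((2 : ℤ) ^ 8 ∣ x ∧ (2 : ℤ) ^ 11 ∣ y ∧ (2 : ℤ) ^ 12 * 1728 ∣ x ^ 3 - y ^ 2) ∧
        ¬ ((3 : ℤ) ^ 4 ∣ x ∧ (3 : ℤ) ^ 9 ∣ y ∧ (3 : ℤ) ^ 12 * 1728 ∣ x ^ 3 - y ^ 2))
    (hcop : ∀ p : ℕ, p.Prime → 5 ≤ p → (p : ℤ) ∣ x → ¬ (p : ℤ) ∣ x ^ 3 - y ^ 2) :
    g ∣ 72 := by
  have hg0 : g ≠ 0 := hg.ne'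
  -- prime factors of `g` are `2` or `3`
  have hpf : ∀ p : ℕ, p.Prime → p ∣ g → p = 2 ∨ p = 3 := by
    intro p hp hpg
    by_contra hne
    push Not at hne
    have h5 : 5 ≤ p := by
      have := hp.two_le
      rcases (show p = 2 ∨ p = 3 ∨ p = 4 ∨ 5 ≤ p by omega) with h | h | h | h
      · exact absurd h hne.1
      · exact absurd h hne.2
      · exfalso; rw [h] at hp; exact (by decide : ¬ Nat.Prime 4) hp
      · exact h
    have hpg' : (p : ℤ) ∣ (g : ℤ) := Int.natCast_dvd_natCast.mpr hpg
    have hpx : (p : ℤ) ∣ x := (dvd_pow hpg' two_ne_zero).trans hgx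
    have hpy : (p : ℤ) ∣ y := (dvd_pow hpg' three_ne_zero).trans hgy
    exact hcop p hp h5 hpx (dvd_sub (dvd_pow hpx three_ne_zero) (dvd_pow hpy two_ne_zero))
  have h27 : (27 : ℤ) ∣ x ^ 3 - y ^ 2 := (by norm_num : (27 : ℤ) ∣ 1728).trans h1728
  have h64 : (64 : ℤ) ∣ x ^ 3 - y ^ 2 := (by norm_num : (64 : ℤ) ∣ 1728).trans h1728
  -- `2⁴ ∤ g`
  have h16 : ¬ 2 ^ 4 ∣ g := by
    intro h
    have h2 : (2 : ℤ) ^ 4 ∣ (g : ℤ) := by exact_mod_cast h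
    have hx8 : (2 : ℤ) ^ 8 ∣ x := by
      have := pow_dvd_pow_of_dvd h2 2; rw [← pow_mul] at this; exact this.trans hgx
    have hy12 : (2 : ℤ) ^ 12 ∣ y := by
      have := pow_dvd_pow_of_dvd h2 3; rw [← pow_mul] at this; exact this.trans hgy
    have hz24 : (2 : ℤ) ^ 24 ∣ x ^ 3 - y ^ 2 := by
      refine dvd_sub ?_ ?_
      · have := pow_dvd_pow_of_dvd hx8 3; rwa [← pow_mul] at this
      · have := pow_dvd_pow_of_dvd hy12 2; rwa [← pow_mul] at this
    have hz : (2 : ℤ) ^ 12 * 1728 ∣ x ^ 3 - y ^ 2 := by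
      rw [show (2 : ℤ) ^ 12 * 1728 = 2 ^ 18 * 27 by norm_num]
      refine IsCoprime.mul_dvd (Int.isCoprime_iff_gcd_eq_one.mpr (by norm_num)) ?_ h27
      exact (pow_dvd_pow 2 (by norm_num : 18 ≤ 24)).trans hz24
    exact hprim.1 ⟨hx8, (pow_dvd_pow 2 (by norm_num : 11 ≤ 12)).trans hy12, hz⟩
  -- `3³ ∤ g`
  have h27g : ¬ 3 ^ 3 ∣ g := by
    intro h
    have h3 : (3 : ℤ) ^ 3 ∣ (g : ℤ) := by exact_mod_cast h
    have hx6 : (3 : ℤ) ^ 6 ∣ x := by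
      have := pow_dvd_pow_of_dvd h3 2; rw [← pow_mul] at this; exact this.trans hgx
    have hy9 : (3 : ℤ) ^ 9 ∣ y := by
      have := pow_dvd_pow_of_dvd h3 3; rw [← pow_mul] at this; exact this.trans hgy
    have hz18 : (3 : ℤ) ^ 18 ∣ x ^ 3 - y ^ 2 := by
      refine dvd_sub ?_ ?_
      · have := pow_dvd_pow_of_dvd hx6 3; rwa [← pow_mul] at this
      · have := pow_dvd_pow_of_dvd hy9 2; rwa [← pow_mul] at this
    have hz : (3 : ℤ) ^ 12 * 1728 ∣ x ^ 3 - y ^ 2 := by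
      rw [show (3 : ℤ) ^ 12 * 1728 = 3 ^ 15 * 64 by norm_num]
      refine IsCoprime.mul_dvd (Int.isCoprime_iff_gcd_eq_one.mpr (by norm_num)) ?_ h64
      exact (pow_dvd_pow 3 (by norm_num : 15 ≤ 18)).trans hz18
    exact hprim.2 ⟨(pow_dvd_pow 3 (by norm_num : 4 ≤ 6)).trans hx6, hy9, hz⟩
  -- hence `g ∣ 2³ · 3²`
  rw [← Nat.factorization_le_iff_dvd hg0 (by norm_num : (72 : ℕ) ≠ 0)]
  intro p
  by_cases hp : p.Prime
  · by_cases hpg : p ∣ g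
    · rcases hpf p hp hpg with rfl | rfl
      · have h1 : g.factorization 2 < 4 := by
          by_contra hh
          push Not at hh
          exact h16 ((Nat.prime_two.pow_dvd_iff_le_factorization hg0).mpr hh)
        have h2 : 3 ≤ (72 : ℕ).factorization 2 :=
          (Nat.prime_two.pow_dvd_iff_le_factorization (by norm_num)).mp (by norm_num)
        omega
      · have h1 : g.factorization 3 < 3 := by
          by_contra hh
          push Not at hh
          exact h27g ((Nat.prime_three.pow_dvd_iff_le_factorization hg0).mpr hh)
        have h2 : 2 ≤ (72 : ℕ).factorization 3 :=
          (Nat.prime_three.pow_dvd_iff_le_factorization (by norm_num)).mp (by norm_num)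
        omega
    · rw [Nat.factorization_eq_zero_of_not_dvd hpg]; exact Nat.zero_le _
  · rw [Nat.factorization_eq_zero_of_not_prime _ hp]; exact Nat.zero_le _

/-- **The line's normal form follows from the strong Hall conjecture** (B–G 12.5.3), for every class
exponent `θ` and with the class condition unused: descale to a primitive solution (`g ∣ 72` by `Prim23`),
apply strong Hall, and use `rad |z'| ≤ rad |z| ≤ 6 · rad5 z`, `wt5 z ≥ 1`. Constant:
`2 · 72⁶ · max(C_{ε/3}, 1)³ · 6^{6+ε}`. [folklore] -/
theorem thinStrongHallBody_of_strongHall (hSH : StrongHallConjecture) (θ : ℝ) :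
    ∀ ε : ℝ, 0 < ε → ∀ K : ℝ, ∃ C : ℝ, ∀ x y : ℤ, x ^ 3 - y ^ 2 ≠ 0 →
      (1728 : ℤ) ∣ x ^ 3 - y ^ 2 →
      (¬ ((2 : ℤ) ^ 8 ∣ x ∧ (2 : ℤ) ^ 11 ∣ y ∧ (2 : ℤ) ^ 12 * 1728 ∣ x ^ 3 - y ^ 2) ∧
        ¬ ((3 : ℤ) ^ 4 ∣ x ∧ (3 : ℤ) ^ 9 ∣ y ∧ (3 : ℤ) ^ 12 * 1728 ∣ x ^ 3 - y ^ 2)) →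
      (∀ p : ℕ, p.Prime → 5 ≤ p → (p : ℤ) ∣ x → ¬ (p : ℤ) ∣ x ^ 3 - y ^ 2) →
      (wt5 (x ^ 3 - y ^ 2) : ℝ) ≤ K * (rad5 (x ^ 3 - y ^ 2) : ℝ) ^ θ →
      ((max |x ^ 3 - y ^ 2| (|x| ^ 3) : ℤ) : ℝ) ≤
        C * ((rad5 (x ^ 3 - y ^ 2) : ℝ) * (wt5 (x ^ 3 - y ^ 2) : ℝ)) ^ (6 + ε) := by
  intro ε hε K
  obtain ⟨C, hC⟩ := hSH (ε / 3) (by positivity)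
  set Cp : ℝ := max C 1 with hCp
  have hCp1 : 1 ≤ Cp := le_max_right _ _
  have hCp0 : 0 ≤ Cp := zero_le_one.trans hCp1
  refine ⟨2 * 72 ^ 6 * Cp ^ 3 * (6 : ℝ) ^ (6 + ε), fun x y hz h1728 hprim hcop _ ↦ ?_⟩
  obtain ⟨g, x', y', hg, hx, hy, hsol⟩ := exists_primitive_descaling x y hz
  have hg72 : g ∣ 72 :=
    descaling_dvd_72 hg (Dvd.intro _ hx.symm) (Dvd.intro _ hy.symm) h1728 hprim hcop
  set z : ℤ := x ^ 3 - y ^ 2 with hzdef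
  set z' : ℤ := x' ^ 3 - y' ^ 2 with hz'def
  have hzz' : z = (g : ℤ) ^ 6 * z' := by rw [hzdef, hz'def, hx, hy]; ring
  obtain ⟨hX, hY⟩ := hC x' y' z' hsol
  -- radicals
  set R' : ℝ := ((radical z'.natAbs : ℕ) : ℝ) with hR'
  set R : ℝ := (rad5 z : ℝ) with hR
  have hR'0 : 0 ≤ R' := by positivity
  have hR'le : R' ≤ 6 * R := by
    have h1 := radical_natAbs_le_of_dvd (Dvd.intro_left _ hzz'.symm) hz
    have h2 := radical_natAbs_le_six_mul_rad5 z
    rw [hR', hR]; exact_mod_cast h1.trans h2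
  have hR1 : 1 ≤ R := by rw [hR]; exact_mod_cast one_le_rad5 z
  set S : ℝ := 6 * R with hS
  have hS1 : 1 ≤ S := by linarith
  have hS0 : 0 ≤ S := by linarith
  have hε3 : 0 ≤ 2 + ε / 3 := by positivity
  have hε3' : 0 ≤ 3 + ε / 3 := by positivity
  -- strong Hall, transported to `S = 6 rad5 z`
  have hX' : (|x'| : ℝ) ≤ Cp * S ^ (2 + ε / 3) := by
    calc (|x'| : ℝ) ≤ C * R' ^ (2 + ε / 3) := by exact_mod_cast hX
      _ ≤ Cp * R' ^ (2 + ε / 3) := mul_le_mul_of_nonneg_right (le_max_left _ _) (by positivity)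
      _ ≤ Cp * S ^ (2 + ε / 3) :=
          mul_le_mul_of_nonneg_left (Real.rpow_le_rpow hR'0 hR'le hε3) hCp0
  have hY' : (|y'| : ℝ) ≤ Cp * S ^ (3 + ε / 3) := by
    calc (|y'| : ℝ) ≤ C * R' ^ (3 + ε / 3) := by exact_mod_cast hY
      _ ≤ Cp * R' ^ (3 + ε / 3) := mul_le_mul_of_nonneg_right (le_max_left _ _) (by positivity)
      _ ≤ Cp * S ^ (3 + ε / 3) :=
          mul_le_mul_of_nonneg_left (Real.rpow_le_rpow hR'0 hR'le hε3') hCp0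
  -- `g ≤ 72`
  have hg0R : (0 : ℝ) ≤ g := by positivity
  have hg72R : (g : ℝ) ≤ 72 := by exact_mod_cast Nat.le_of_dvd (by norm_num) hg72
  have hg6 : (g : ℝ) ^ 6 ≤ 72 ^ 6 := pow_le_pow_left₀ hg0R hg72R 6
  -- `|x'|³ ≤ Cp³ S^{6+ε}` and `|y'|² ≤ Cp³ S^{6+ε}`
  have hx'3 : (|x'| : ℝ) ^ 3 ≤ Cp ^ 3 * S ^ (6 + ε) := by
    have h2 : (|x'| : ℝ) ^ 3 ≤ (Cp * S ^ (2 + ε / 3)) ^ 3 := pow_le_pow_left₀ (abs_nonneg _) hX' 3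
    have h3 : (S ^ (2 + ε / 3)) ^ 3 = S ^ (6 + ε) := by
      rw [← Real.rpow_natCast (S ^ (2 + ε / 3)) 3, ← Real.rpow_mul hS0]; norm_num; ring_nf
    rw [mul_pow, h3] at h2
    exact h2
  have hy'2 : (|y'| : ℝ) ^ 2 ≤ Cp ^ 3 * S ^ (6 + ε) := by
    have h2 : (|y'| : ℝ) ^ 2 ≤ (Cp * S ^ (3 + ε / 3)) ^ 2 := pow_le_pow_left₀ (abs_nonneg _) hY' 2
    have h3 : (S ^ (3 + ε / 3)) ^ 2 = S ^ (6 + 2 * ε / 3) := by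
      rw [← Real.rpow_natCast (S ^ (3 + ε / 3)) 2, ← Real.rpow_mul hS0]; norm_num; ring_nf
    rw [mul_pow, h3] at h2
    have h5 : Cp ^ 2 ≤ Cp ^ 3 := pow_le_pow_right₀ hCp1 (by norm_num)
    have h6 : S ^ (6 + 2 * ε / 3) ≤ S ^ (6 + ε) := Real.rpow_le_rpow_of_exponent_le hS1 (by linarith)
    exact h2.trans (mul_le_mul h5 h6 (by positivity) (by positivity))
  -- `|x|³ = g⁶ |x'|³`, `|z| = g⁶ |z'| ≤ g⁶ (|x'|³ + |y'|²)`
  have habsg : |(g : ℝ)| = g := abs_of_nonneg hg0R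
  have hx3 : (((|x| ^ 3 : ℤ)) : ℝ) ≤ 72 ^ 6 * Cp ^ 3 * S ^ (6 + ε) := by
    have h1 : (((|x| ^ 3 : ℤ)) : ℝ) = (g : ℝ) ^ 6 * (|x'| : ℝ) ^ 3 := by
      rw [hx]; push_cast; rw [abs_mul, abs_pow, habsg]; ring
    rw [h1]
    calc (g : ℝ) ^ 6 * (|x'| : ℝ) ^ 3 ≤ 72 ^ 6 * (Cp ^ 3 * S ^ (6 + ε)) :=
          mul_le_mul hg6 hx'3 (by positivity) (by positivity)
      _ = 72 ^ 6 * Cp ^ 3 * S ^ (6 + ε) := by ring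
  have hzb : ((|z| : ℤ) : ℝ) ≤ 2 * 72 ^ 6 * Cp ^ 3 * S ^ (6 + ε) := by
    have h1 : ((|z| : ℤ) : ℝ) = (g : ℝ) ^ 6 * |(z' : ℝ)| := by
      rw [hzz']; push_cast; rw [abs_mul, abs_pow, habsg]
    have h2 : |(z' : ℝ)| ≤ (|x'| : ℝ) ^ 3 + (|y'| : ℝ) ^ 2 := by
      have : (z' : ℝ) = (x' : ℝ) ^ 3 - (y' : ℝ) ^ 2 := by rw [hz'def]; push_cast; ring
      rw [this]
      calc |(x' : ℝ) ^ 3 - (y' : ℝ) ^ 2| ≤ |(x' : ℝ) ^ 3| + |(y' : ℝ) ^ 2| := abs_sub _ _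
        _ = (|x'| : ℝ) ^ 3 + (|y'| : ℝ) ^ 2 := by rw [abs_pow, abs_pow]
    rw [h1]
    calc (g : ℝ) ^ 6 * |(z' : ℝ)| ≤ 72 ^ 6 * (Cp ^ 3 * S ^ (6 + ε) + Cp ^ 3 * S ^ (6 + ε)) :=
          mul_le_mul hg6 (h2.trans (add_le_add hx'3 hy'2)) (abs_nonneg _) (by positivity)
      _ = 2 * 72 ^ 6 * Cp ^ 3 * S ^ (6 + ε) := by ring
  -- assemble
  have hSsplit : S ^ (6 + ε) = (6 : ℝ) ^ (6 + ε) * R ^ (6 + ε) := by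
    rw [hS]; exact Real.mul_rpow (by norm_num) (by linarith)
  have hW1 : (1 : ℝ) ≤ (wt5 z : ℝ) := by exact_mod_cast one_le_wt5 z
  have hRW : R ^ (6 + ε) ≤ (R * (wt5 z : ℝ)) ^ (6 + ε) :=
    Real.rpow_le_rpow (by linarith) (le_mul_of_one_le_right (by linarith) hW1) (by positivity)
  have hpos : (0 : ℝ) ≤ 72 ^ 6 * Cp ^ 3 * S ^ (6 + ε) := by positivity
  have hmax : ((max |z| (|x| ^ 3) : ℤ) : ℝ) ≤ 2 * 72 ^ 6 * Cp ^ 3 * S ^ (6 + ε) := by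
    rw [Int.cast_max]
    exact max_le hzb (hx3.trans (by linarith))
  calc ((max |z| (|x| ^ 3) : ℤ) : ℝ) ≤ 2 * 72 ^ 6 * Cp ^ 3 * S ^ (6 + ε) := hmax
    _ = (2 * 72 ^ 6 * Cp ^ 3 * (6 : ℝ) ^ (6 + ε)) * R ^ (6 + ε) := by rw [hSsplit]; ring
    _ ≤ (2 * 72 ^ 6 * Cp ^ 3 * (6 : ℝ) ^ (6 + ε)) * (R * (wt5 z : ℝ)) ^ (6 + ε) :=
        mul_le_mul_of_nonneg_left hRW (by positivity)

/-- … hence from the abc conjecture (`≤`-form ⟸ `ABC`; tree: `strongHall_of_abcLe`, B–G 12.5.12 (a) ⟹ (b)). [folklore] -/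
theorem thinStrongHallBody_of_abc (h : _root_.ABC) (θ : ℝ) :
    ∀ ε : ℝ, 0 < ε → ∀ K : ℝ, ∃ C : ℝ, ∀ x y : ℤ, x ^ 3 - y ^ 2 ≠ 0 →
      (1728 : ℤ) ∣ x ^ 3 - y ^ 2 →
      (¬ ((2 : ℤ) ^ 8 ∣ x ∧ (2 : ℤ) ^ 11 ∣ y ∧ (2 : ℤ) ^ 12 * 1728 ∣ x ^ 3 - y ^ 2) ∧
        ¬ ((3 : ℤ) ^ 4 ∣ x ∧ (3 : ℤ) ^ 9 ∣ y ∧ (3 : ℤ) ^ 12 * 1728 ∣ x ^ 3 - y ^ 2)) →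
      (∀ p : ℕ, p.Prime → 5 ≤ p → (p : ℤ) ∣ x → ¬ (p : ℤ) ∣ x ^ 3 - y ^ 2) →
      (wt5 (x ^ 3 - y ^ 2) : ℝ) ≤ K * (rad5 (x ^ 3 - y ^ 2) : ℝ) ^ θ →
      ((max |x ^ 3 - y ^ 2| (|x| ^ 3) : ℤ) : ℝ) ≤
        C * ((rad5 (x ^ 3 - y ^ 2) : ℝ) * (wt5 (x ^ 3 - y ^ 2) : ℝ)) ^ (6 + ε) := by
  refine thinStrongHallBody_of_strongHall (strongHall_of_abcLe fun ε hε ↦ ?_) θ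
  obtain ⟨C, -, hC⟩ := h ε hε
  exact ⟨C, fun a b c ht ↦ (hC a b c ht).le⟩

/-- **Targets (the ACTIVE stubs `stub_cusp : ThinStrongHallCusp`, `stub_bulk : ThinStrongHallBulk` of the
lead's skeleton 47263e09).** Both are regime restrictions `ThinLaw R` of the normal form, so both follow from abc
for every regime predicate `R` and every `θ` (corollary of `thinStrongHallBody_of_abc`; `R`, `θ`, `K` unused):
no disprover target among the active stubs short of `¬ abc`. Stated over the verbatim `HallIneq` shape with a
free regime `R`. [folklore] -/
theorem thinLawBody_of_abc (h : _root_.ABC) (R : ℤ → ℤ → Prop) (θ : ℝ) :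
    ∀ ε : ℝ, 0 < ε → ∀ K : ℝ, ∃ C : ℝ, ∀ x y : ℤ, x ^ 3 - y ^ 2 ≠ 0 →
      (1728 : ℤ) ∣ x ^ 3 - y ^ 2 →
      (¬ ((2 : ℤ) ^ 8 ∣ x ∧ (2 : ℤ) ^ 11 ∣ y ∧ (2 : ℤ) ^ 12 * 1728 ∣ x ^ 3 - y ^ 2) ∧
        ¬ ((3 : ℤ) ^ 4 ∣ x ∧ (3 : ℤ) ^ 9 ∣ y ∧ (3 : ℤ) ^ 12 * 1728 ∣ x ^ 3 - y ^ 2)) →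
      R x y →
      (∀ p : ℕ, p.Prime → 5 ≤ p → (p : ℤ) ∣ x → ¬ (p : ℤ) ∣ x ^ 3 - y ^ 2) →
      (wt5 (x ^ 3 - y ^ 2) : ℝ) ≤ K * (rad5 (x ^ 3 - y ^ 2) : ℝ) ^ θ →
      ((max |x ^ 3 - y ^ 2| (|x| ^ 3) : ℤ) : ℝ) ≤
        C * ((rad5 (x ^ 3 - y ^ 2) : ℝ) * (wt5 (x ^ 3 - y ^ 2) : ℝ)) ^ (6 + ε) := by
  intro ε hε K
  obtain ⟨C, hC⟩ := thinStrongHallBody_of_abc h θ ε hε K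
  exact ⟨C, fun x y hz h1728 hprim _ hcop hthin ↦ hC x y hz h1728 hprim hcop hthin⟩

end StrongHallTransfer

/-- A {2,3}-unit has `rad5 = wt5 = 1`. [folklore] -/
theorem rad5_wt5_eq_one {z : ℤ} (h : z.natAbs.primeFactors ⊆ {2, 3}) : rad5 z = 1 ∧ wt5 z = 1 := by
  have he : z.natAbs.primeFactors.filter (fun p => 5 ≤ p) = ∅ := by
    rw [Finset.filter_eq_empty_iff]
    intro p hp
    have := h hp
    simp only [Finset.mem_insert, Finset.mem_singleton] at this
    omega
  simp [rad5, wt5, he]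

/-- `1728 · 64ʲ = 2^{6j+6} · 3³` is a {2,3}-unit. [folklore] -/
theorem primeFactors_scaled (j : ℕ) : ((1728 * 64 ^ j : ℤ)).natAbs.primeFactors ⊆ {2, 3} := by
  have h : ((1728 * 64 ^ j : ℤ)).natAbs = 2 ^ (6 * j + 6) * 3 ^ 3 := by
    have : (1728 * 64 ^ j : ℤ) = ((2 ^ (6 * j + 6) * 3 ^ 3 : ℕ) : ℤ) := by
      push_cast
      rw [pow_add, pow_mul]
      norm_num
      ring
    rw [this, Int.natAbs_natCast]
  rw [h, Nat.primeFactors_mul (by positivity) (by norm_num),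
    Nat.primeFactors_prime_pow (by omega) Nat.prime_two, Nat.primeFactors_prime_pow (by norm_num) Nat.prime_three]
  intro p hp
  simpa using hp

/-- **`Prim23` is load-bearing in the line's normal form**: `ThinStrongHall` with the primitivity-at-2,3
hypothesis `Prim23` dropped (everything else verbatim, regime `True`) is FALSE, whatever `θ`. Witness:
`(x, y) = (12·4ʲ, 0)`, `z = x³ = 1728·64ʲ`: `z ≠ 0`, `1728 ∣ z`, no prime `≥ 5` divides `x`,
`rad5 z = wt5 z = 1` (thin with `K = 1`), `|z| → ∞`. (`Prim23` excludes these for `j ≥ 3`.) [folklore] -/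
theorem thinStrongHall_false_without_prim23 :
    ¬ (∃ θ : ℝ, 0 < θ ∧ ∀ ε : ℝ, 0 < ε → ∀ K : ℝ, ∃ C : ℝ, ∀ x y : ℤ, x ^ 3 - y ^ 2 ≠ 0 →
        (1728 : ℤ) ∣ x ^ 3 - y ^ 2 →
        (∀ p : ℕ, p.Prime → 5 ≤ p → (p : ℤ) ∣ x → ¬ (p : ℤ) ∣ x ^ 3 - y ^ 2) →
        (wt5 (x ^ 3 - y ^ 2) : ℝ) ≤ K * (rad5 (x ^ 3 - y ^ 2) : ℝ) ^ θ →
        ((max |x ^ 3 - y ^ 2| (|x| ^ 3) : ℤ) : ℝ) ≤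
          C * ((rad5 (x ^ 3 - y ^ 2) : ℝ) * (wt5 (x ^ 3 - y ^ 2) : ℝ)) ^ (6 + ε)) := by
  rintro ⟨θ, -, h⟩
  obtain ⟨C, hC⟩ := h 1 one_pos 1
  obtain ⟨j, hj⟩ := pow_unbounded_of_one_lt C (by norm_num : (1 : ℝ) < 64)
  have hz : (12 * 4 ^ j : ℤ) ^ 3 - 0 ^ 2 = 1728 * 64 ^ j := by
    rw [mul_pow, ← pow_mul, mul_comm j 3, pow_mul]; norm_num
  obtain ⟨hrad, hwt⟩ := rad5_wt5_eq_one (primeFactors_scaled j)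
  have hz0 : (1728 * 64 ^ j : ℤ) ≠ 0 := by positivity
  have hcop : ∀ p : ℕ, p.Prime → 5 ≤ p → (p : ℤ) ∣ 12 * 4 ^ j → ¬ (p : ℤ) ∣ (12 * 4 ^ j : ℤ) ^ 3 - 0 ^ 2 := by
    intro p hp h5 hdvd
    exfalso
    have h' : p ∣ 2 ^ (2 * j + 2) * 3 := by
      have : (12 * 4 ^ j : ℤ) = ((2 ^ (2 * j + 2) * 3 : ℕ) : ℤ) := by
        push_cast; rw [pow_add, pow_mul]; norm_num; ring
      rw [this] at hdvd
      exact_mod_cast hdvd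
    rcases (Nat.Prime.dvd_mul hp).mp h' with h2 | h3
    · have := (Nat.prime_dvd_prime_iff_eq hp Nat.prime_two).mp (hp.dvd_of_dvd_pow h2); omega
    · have := (Nat.prime_dvd_prime_iff_eq hp Nat.prime_three).mp h3; omega
  have key := hC (12 * 4 ^ j) 0 (by rw [hz]; exact hz0) (by rw [hz]; exact dvd_mul_right _ _) hcop
    (by rw [hz, hrad, hwt]; norm_num)
  rw [hz, hrad, hwt] at key
  norm_num at key
  have h2 : (64 : ℝ) ^ j ≤ 1728 * (64 : ℝ) ^ j := by nlinarith [pow_pos (by norm_num : (0:ℝ) < 64) j]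
  linarith [key.1]

/-! ### 6b. Targets: the cusp stub is exponent-sharp inside every thin class (elementary)

`stub_cusp : ThinStrongHallCusp` is `∀ ε > 0` of the cusp normal form with exponent `6 + ε`. Its natural
strengthening to an exponent `κ < 6` is FALSE in every thin class, by the Frey points
`(x_b, y_b) = (16(b² + b + 1), 32(b − 1)(2b + 1)(b + 2))`, `x_b³ − y_b² = 1728·16·(b(b+1))²`, at `b = p^m`:
purely arithmetic witnesses (no conductor theory), certified thin by `p ≤ rad5 z` and the divisor bound.
So neither the weight nor the thinness hypothesis gives the lead any slack in the cusp exponent.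

For `stub_bulk` the analogous certificate stops at exponent `2`: bulk points (`|x|³ < |z|`) with `|z|` far
above `rad5 z · wt5 z` are powerful values of `x³ − y²` at bounded `x`, and in families only Pell squares
are available — e.g. `x = 12`, `y = 72w`, `3w² − 2u² = 1` gives `z = −3456 u²` (admissible: no prime
`≥ 5` divides `x`, `1728 ∣ z`, `Prim23` holds as `2⁸ ∤ 12`), killing exponents `κ < 2` only; exponent-`3`
and higher analogues lead to Mordell / Thue–Mahler equations with finitely many solutions (`3w² = 2u³ + 1`,
`y² − 1 = 2^a 3^b m` with `rad5 m · wt5 m` bounded: S-unit finiteness). Not formalised; recorded so that a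
re-armed seat does not retry the bulk corner below exponent `2`. -/

section CuspTargets

open UniqueFactorizationMonoid Literature.NumberTheory.Sieve

/-- The cusp half of the line's normal form with exponent `κ` in place of `6 + ε`
(`ThinStrongHallCusp` = `∀ ε > 0`, exponent `6 + ε`, same `θ`). -/
def CuspBodyExp (κ : ℝ) : Prop :=
  ∃ θ : ℝ, 0 < θ ∧ ∀ K : ℝ, ∃ C : ℝ, ∀ x y : ℤ, x ^ 3 - y ^ 2 ≠ 0 →
    (1728 : ℤ) ∣ x ^ 3 - y ^ 2 →
    (¬ ((2 : ℤ) ^ 8 ∣ x ∧ (2 : ℤ) ^ 11 ∣ y ∧ (2 : ℤ) ^ 12 * 1728 ∣ x ^ 3 - y ^ 2) ∧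
      ¬ ((3 : ℤ) ^ 4 ∣ x ∧ (3 : ℤ) ^ 9 ∣ y ∧ (3 : ℤ) ^ 12 * 1728 ∣ x ^ 3 - y ^ 2)) →
    |x ^ 3 - y ^ 2| ≤ |x| ^ 3 →
    (∀ p : ℕ, p.Prime → 5 ≤ p → (p : ℤ) ∣ x → ¬ (p : ℤ) ∣ x ^ 3 - y ^ 2) →
    (wt5 (x ^ 3 - y ^ 2) : ℝ) ≤ K * (rad5 (x ^ 3 - y ^ 2) : ℝ) ^ θ →
    ((max |x ^ 3 - y ^ 2| (|x| ^ 3) : ℤ) : ℝ) ≤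
      C * ((rad5 (x ^ 3 - y ^ 2) : ℝ) * (wt5 (x ^ 3 - y ^ 2) : ℝ)) ^ κ

/-- Frey points of the normal form: `(x_b, y_b) = (c₄, |c₆|)` of the B–G (12.17) model of `1 + b = b + 1`. -/
def freyX (b : ℕ) : ℤ := 16 * (1 + b + (b : ℤ) ^ 2)

/-- See `freyX`. -/
def freyY (b : ℕ) : ℤ := 32 * ((b : ℤ) - 1) * (2 * b + 1) * (b + 2)

/-- `x_b³ − y_b² = 1728 · 16 · (b(b+1))²` (the discriminant relation `c₄³ − c₆² = 1728 Δ`). [folklore] -/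
theorem frey_z (b : ℕ) : freyX b ^ 3 - freyY b ^ 2 = ((27648 * (b * (b + 1)) ^ 2 : ℕ) : ℤ) := by
  unfold freyX freyY; push_cast; ring

/-- `x_b = 16 · (b² + b + 1)` as a cast. [folklore] -/
theorem freyX_eq (b : ℕ) : freyX b = ((16 * (b ^ 2 + b + 1) : ℕ) : ℤ) := by
  unfold freyX; push_cast; ring

/-- `b² + b + 1` is odd and not divisible by `9` (residues mod `2` and mod `9`). [folklore] -/
theorem sq_add_self_add_one_facts (b : ℕ) : ¬ 2 ∣ b ^ 2 + b + 1 ∧ ¬ 9 ∣ b ^ 2 + b + 1 := by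
  constructor
  · intro h
    have h2 : ((b ^ 2 + b + 1 : ℕ) : ZMod 2) = 0 := (ZMod.natCast_eq_zero_iff _ _).mpr h
    push_cast at h2
    have key : ∀ r : ZMod 2, r ^ 2 + r + 1 ≠ 0 := by decide
    exact key _ h2
  · intro h
    have h9 : ((b ^ 2 + b + 1 : ℕ) : ZMod 9) = 0 := (ZMod.natCast_eq_zero_iff _ _).mpr h
    push_cast at h9
    have key : ∀ r : ZMod 9, r ^ 2 + r + 1 ≠ 0 := by decide
    exact key _ h9

/-- Side conditions of the normal form at the Frey points, for every `b ≥ 1`: `z ≠ 0`, `1728 ∣ z`,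
`Prim23` (as `2⁸ ∤ x`, `3⁴ ∤ x`), the cusp regime `|z| ≤ |x|³`, and no prime `≥ 5` divides both `x` and
`z`. [folklore] -/
theorem frey_side_conditions (b : ℕ) (hb : 1 ≤ b) :
    freyX b ^ 3 - freyY b ^ 2 ≠ 0 ∧ (1728 : ℤ) ∣ freyX b ^ 3 - freyY b ^ 2 ∧
    (¬ ((2 : ℤ) ^ 8 ∣ freyX b ∧ (2 : ℤ) ^ 11 ∣ freyY b ∧ (2 : ℤ) ^ 12 * 1728 ∣ freyX b ^ 3 - freyY b ^ 2) ∧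
      ¬ ((3 : ℤ) ^ 4 ∣ freyX b ∧ (3 : ℤ) ^ 9 ∣ freyY b ∧ (3 : ℤ) ^ 12 * 1728 ∣ freyX b ^ 3 - freyY b ^ 2)) ∧
    |freyX b ^ 3 - freyY b ^ 2| ≤ |freyX b| ^ 3 ∧
    (∀ p : ℕ, p.Prime → 5 ≤ p → (p : ℤ) ∣ freyX b → ¬ (p : ℤ) ∣ freyX b ^ 3 - freyY b ^ 2) := by
  obtain ⟨hodd, h9⟩ := sq_add_self_add_one_facts b
  have hz := frey_z b
  have hprod : 0 < 27648 * (b * (b + 1)) ^ 2 := by positivity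
  refine ⟨?_, ?_, ⟨?_, ?_⟩, ?_, ?_⟩
  · rw [hz]; exact_mod_cast hprod.ne'
  · rw [hz]; exact_mod_cast (Dvd.intro _ rfl : 1728 ∣ 1728 * (16 * (b * (b + 1)) ^ 2)).trans (by ring_nf; exact dvd_refl _)
  · rintro ⟨hx, -, -⟩
    rw [freyX_eq] at hx
    have hx' : 2 ^ 8 ∣ 16 * (b ^ 2 + b + 1) := by exact_mod_cast hx
    have : 2 ^ 4 ∣ b ^ 2 + b + 1 := by
      have h16 : (2 : ℕ) ^ 8 = 16 * 2 ^ 4 := by norm_num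
      rw [h16] at hx'
      exact Nat.dvd_of_mul_dvd_mul_left (by norm_num) hx'
    exact hodd ((dvd_pow_self 2 (by norm_num)).trans this)
  · rintro ⟨hx, -, -⟩
    rw [freyX_eq] at hx
    have hx' : 3 ^ 4 ∣ 16 * (b ^ 2 + b + 1) := by exact_mod_cast hx
    have h81 : 81 ∣ b ^ 2 + b + 1 :=
      (Nat.Coprime.dvd_of_dvd_mul_left (by norm_num : Nat.Coprime 81 16) (by simpa using hx'))
    exact h9 ((by norm_num : (9:ℕ) ∣ 81).trans h81)
  · -- cusp: `z = x³ − y² ≤ x³` and `z > 0`, `x > 0`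
    have hx0 : 0 < freyX b := by unfold freyX; positivity
    have hz0 : 0 < freyX b ^ 3 - freyY b ^ 2 := by rw [hz]; exact_mod_cast hprod
    rw [abs_of_pos hz0, abs_of_pos hx0]
    nlinarith [sq_nonneg (freyY b)]
  · intro p hp h5 hpx hpz
    rw [hz] at hpz
    rw [freyX_eq] at hpx
    have hpz' : p ∣ 27648 * (b * (b + 1)) ^ 2 := by exact_mod_cast hpz
    have hpx' : p ∣ 16 * (b ^ 2 + b + 1) := by exact_mod_cast hpx
    have hp2 : p ≠ 2 := by omega
    have hp3 : p ≠ 3 := by omega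
    have hpx'' : p ∣ b ^ 2 + b + 1 := by
      rcases (Nat.Prime.dvd_mul hp).mp hpx' with h | h
      · exact absurd ((Nat.prime_dvd_prime_iff_eq hp Nat.prime_two).mp
          (hp.dvd_of_dvd_pow (show p ∣ 2 ^ 4 by simpa using h))) hp2
      · exact h
    have hpz'' : p ∣ b * (b + 1) := by
      rcases (Nat.Prime.dvd_mul hp).mp hpz' with h | h
      · exfalso
        have h27648 : (27648 : ℕ) = 2 ^ 10 * 3 ^ 3 := by norm_num
        rw [h27648] at h
        rcases (Nat.Prime.dvd_mul hp).mp h with h | h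
        · exact hp2 ((Nat.prime_dvd_prime_iff_eq hp Nat.prime_two).mp (hp.dvd_of_dvd_pow h))
        · exact hp3 ((Nat.prime_dvd_prime_iff_eq hp Nat.prime_three).mp (hp.dvd_of_dvd_pow h))
      · exact hp.dvd_of_dvd_pow h
    rcases (Nat.Prime.dvd_mul hp).mp hpz'' with h | h
    · -- `p ∣ b` and `p ∣ b² + b + 1` ⇒ `p ∣ 1`
      have : p ∣ 1 := by
        have h1 : p ∣ b ^ 2 + b := (dvd_pow h two_ne_zero) |>.add h |> fun t ↦ by simpa [sq] using t
        exact (Nat.dvd_add_right h1).mp hpx''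
      exact hp.one_lt.ne' (Nat.dvd_one.mp this)
    · -- `p ∣ b + 1` ⇒ `b² + b + 1 = b (b + 1) + 1`
      have h1 : p ∣ b * (b + 1) := dvd_mul_of_dvd_right h _
      have : p ∣ 1 := by
        have : b ^ 2 + b + 1 = b * (b + 1) + 1 := by ring
        rw [this] at hpx''
        exact (Nat.dvd_add_right h1).mp hpx''
      exact hp.one_lt.ne' (Nat.dvd_one.mp this)

/-- `wt5 z ≤ τ(|z|)`. [folklore] -/
theorem wt5_le_card_divisors (z : ℤ) (hz : z ≠ 0) : wt5 z ≤ z.natAbs.divisors.card := by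
  have hn : z.natAbs ≠ 0 := Int.natAbs_ne_zero.mpr hz
  unfold wt5
  rw [Nat.card_divisors hn]
  calc ∏ p ∈ z.natAbs.primeFactors with 5 ≤ p, z.natAbs.factorization p
      ≤ ∏ p ∈ z.natAbs.primeFactors with 5 ≤ p, (z.natAbs.factorization p + 1) :=
        Finset.prod_le_prod (fun _ _ ↦ Nat.zero_le _) (fun _ _ ↦ Nat.le_succ _)
    _ ≤ ∏ p ∈ z.natAbs.primeFactors, (z.natAbs.factorization p + 1) :=
        Finset.prod_le_prod_of_subset_of_one_le' (Finset.filter_subset _ _) (fun _ _ _ ↦ Nat.le_add_left 1 _)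

/-- At the Frey point of `b = p^m` (`p ≥ 5` prime, `m ≥ 1`): `p ≤ rad5 z ≤ p (b + 1)`. [folklore] -/
theorem rad5_frey_bounds {p m : ℕ} (hp : p.Prime) (h5 : 5 ≤ p) (hm : 1 ≤ m) :
    p ≤ rad5 (freyX (p ^ m) ^ 3 - freyY (p ^ m) ^ 2) ∧
    rad5 (freyX (p ^ m) ^ 3 - freyY (p ^ m) ^ 2) ≤ p * (p ^ m + 1) := by
  set b : ℕ := p ^ m with hb
  have hz := frey_z b
  have hn : (freyX b ^ 3 - freyY b ^ 2).natAbs = 27648 * (b * (b + 1)) ^ 2 := by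
    rw [hz, Int.natAbs_natCast]
  have hn0 : 27648 * (b * (b + 1)) ^ 2 ≠ 0 := by positivity
  have hpb : p ∣ b := by rw [hb]; exact dvd_pow_self p (by omega)
  constructor
  · -- `p` is one of the factors
    unfold rad5
    rw [hn]
    have hmem : p ∈ (27648 * (b * (b + 1)) ^ 2).primeFactors.filter (fun q ↦ 5 ≤ q) := by
      rw [Finset.mem_filter, Nat.mem_primeFactors]
      exact ⟨⟨hp, dvd_mul_of_dvd_right (dvd_pow (dvd_mul_of_dvd_left hpb _) two_ne_zero) _, hn0⟩, h5⟩
    exact Finset.single_le_prod' (f := fun q ↦ q) (fun q hq ↦ (Nat.mem_primeFactors.mp (Finset.mem_filter.mp hq).1).1.one_lt.le) hmem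
  · -- every factor divides `p (b + 1)`
    unfold rad5
    rw [hn]
    have hk : p * (b + 1) ≠ 0 := by positivity
    apply Nat.le_of_dvd (Nat.pos_of_ne_zero hk)
    apply Finset.prod_primes_dvd
    · intro q hq
      exact Nat.prime_iff.mp (Nat.mem_primeFactors.mp (Finset.mem_filter.mp hq).1).1
    · intro q hq
      obtain ⟨hq1, hq5⟩ := Finset.mem_filter.mp hq
      obtain ⟨hqp, hqd, -⟩ := Nat.mem_primeFactors.mp hq1
      have hq2 : q ≠ 2 := by omega
      have hq3 : q ≠ 3 := by omega
      have hqb : q ∣ b * (b + 1) := by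
        rcases (Nat.Prime.dvd_mul hqp).mp hqd with h | h
        · exfalso
          rw [show (27648 : ℕ) = 2 ^ 10 * 3 ^ 3 by norm_num] at h
          rcases (Nat.Prime.dvd_mul hqp).mp h with h | h
          · exact hq2 ((Nat.prime_dvd_prime_iff_eq hqp Nat.prime_two).mp (hqp.dvd_of_dvd_pow h))
          · exact hq3 ((Nat.prime_dvd_prime_iff_eq hqp Nat.prime_three).mp (hqp.dvd_of_dvd_pow h))
        · exact hqp.dvd_of_dvd_pow h
      rcases (Nat.Prime.dvd_mul hqp).mp hqb with h | h
      · have : q ∣ p := by rw [hb] at h; exact hqp.dvd_of_dvd_pow h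
        exact dvd_mul_of_dvd_left this _
      · exact dvd_mul_of_dvd_right h _

set_option maxHeartbeats 400000 in
/-- **The cusp stub is exponent-sharp inside every thin class**: for every `κ < 6` the cusp normal form
with exponent `κ` (`CuspBodyExp κ`) is FALSE. Witnesses: the Frey points `(x_b, y_b)`, `b = p^m`
(`p ≥ 5` prime → ∞, `m = m(κ)`): all side conditions hold (`frey_side_conditions`), the points are
certified θ-thin for every `θ > 0` (`p ≤ rad5 z`, `wt5 z ≤ τ(|z|) ≤ C_η p^{4mη}`), `|x_b|³ ≥ p^{6m}` while
`rad5 z · wt5 z ≤ 2K p^{m+1+θ}`. Elementary (no elliptic curves, no abc). [folklore] -/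
theorem cuspBodyExp_false_of_lt_six {κ : ℝ} (hκ : κ < 6) : ¬ CuspBodyExp κ := by
  rintro ⟨θ, hθ, hK⟩
  -- exponents
  set k : ℝ := max κ 0 with hk
  have hk0 : 0 ≤ k := le_max_right _ _
  have hk6 : k < 6 := max_lt hκ (by norm_num)
  set θ₁ : ℝ := min θ 1 with hθ₁
  have hθ₁0 : 0 < θ₁ := lt_min hθ one_pos
  have hθ₁1 : θ₁ ≤ 1 := min_le_right _ _
  have hθ₁θ : θ₁ ≤ θ := min_le_left _ _
  -- `m ≥ 1` with `m (6 − k) > 2 k`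
  set m : ℕ := ⌈2 * k / (6 - k)⌉₊ + 1 with hm
  have hm1 : 1 ≤ m := by omega
  have hmR : 2 * k / (6 - k) < m := by
    have := Nat.le_ceil (2 * k / (6 - k))
    push_cast [hm]
    linarith
  have hmk : 2 * k < m * (6 - k) := by rwa [div_lt_iff₀ (by linarith)] at hmR
  have hmpos : (0 : ℝ) < m := by exact_mod_cast hm1
  have hm0 : (m : ℝ) ≠ 0 := hmpos.ne'
  -- divisor bound at `η = θ₁ / (4 m)`
  set η : ℝ := θ₁ / (4 * m) with hη
  have hη0 : 0 < η := by positivity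
  have h4 : ((m * 4 : ℕ) : ℝ) * η = θ₁ := by rw [hη]; push_cast; field_simp
  obtain ⟨Cη, hCη1, hτ⟩ := exists_card_divisors_le_mul_rpow hη0
  have hCη0 : 0 < Cη := by linarith
  set K : ℝ := Cη * (110592 : ℝ) ^ η with hKdef
  have hK0 : 0 < K := by positivity
  obtain ⟨C, hC⟩ := hK K
  -- exponent gap
  set e : ℝ := (m + 1 + θ₁) * k with he
  have he0 : 0 ≤ e := by positivity
  set g : ℝ := 6 * m - e with hg
  have hg0 : 0 < g := by rw [hg, he]; nlinarith
  -- the constant to beat and the prime `p ≥ 5`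
  set M : ℝ := max C 0 * ((2 : ℝ) * K) ^ k with hM
  have hM0 : 0 ≤ M := by positivity
  obtain ⟨p, hpge, hp⟩ := Nat.exists_infinite_primes (max 5 (⌈M ^ (1 / g)⌉₊ + 1))
  have hp5 : 5 ≤ p := le_of_max_le_left hpge
  set P : ℝ := (p : ℝ) with hP
  have hP1 : (1 : ℝ) < P := by rw [hP]; exact_mod_cast (by omega : 1 < p)
  have hP0 : (0 : ℝ) < P := by linarith
  have hPM : M < P ^ g := by
    have h1 : M ^ (1 / g) < P := by
      have := Nat.le_ceil (M ^ (1 / g))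
      have h2 : ((⌈M ^ (1 / g)⌉₊ + 1 : ℕ) : ℝ) ≤ P := by rw [hP]; exact_mod_cast le_of_max_le_right hpge
      push_cast at h2
      linarith
    have h2 : (M ^ (1 / g)) ^ g < P ^ g := Real.rpow_lt_rpow (Real.rpow_nonneg hM0 _) h1 hg0
    rwa [← Real.rpow_mul hM0, one_div_mul_cancel hg0.ne', Real.rpow_one] at h2
  -- the Frey point of `b = p^m`
  set b : ℕ := p ^ m with hb
  have hb1 : 1 ≤ b := Nat.one_le_pow _ _ hp.pos
  obtain ⟨hz0, h1728, hprim, hcusp, hcop⟩ := frey_side_conditions b hb1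
  obtain ⟨hrad_ge, hrad_le⟩ := rad5_frey_bounds hp hp5 hm1
  set z : ℤ := freyX b ^ 3 - freyY b ^ 2 with hzdef
  have hzval := frey_z b
  -- real sizes: `X = p^m = b`
  set X : ℝ := P ^ m with hX
  have hXb : (b : ℝ) = X := by rw [hb, hX, hP]; push_cast; ring
  have hX1 : (1 : ℝ) ≤ X := one_le_pow₀ hP1.le
  have hX0 : (0 : ℝ) < X := by positivity
  -- `p ≤ rad5 z ≤ 2 p X`
  have hR_ge : P ≤ (rad5 z : ℝ) := by rw [hP]; exact_mod_cast hrad_ge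
  have hR1 : (1 : ℝ) ≤ (rad5 z : ℝ) := hP1.le.trans hR_ge
  have hR_le : (rad5 z : ℝ) ≤ 2 * P * X := by
    have h1 : (rad5 z : ℝ) ≤ ((p * (p ^ m + 1) : ℕ) : ℝ) := by exact_mod_cast hrad_le
    have h2 : ((p * (p ^ m + 1) : ℕ) : ℝ) = P * (X + 1) := by rw [hP, hX]; push_cast; ring
    rw [h2] at h1
    nlinarith
  -- `|z| ≤ 110592 X⁴` and `wt5 z ≤ K P^{θ₁}`
  have hzabs : ((z.natAbs : ℕ) : ℝ) ≤ 110592 * X ^ (4 : ℕ) := by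
    have h1 : ((z.natAbs : ℕ) : ℝ) = 27648 * (X * (X + 1)) ^ 2 := by
      rw [hzdef, hzval, Int.natAbs_natCast]; push_cast; rw [hXb]
    rw [h1]
    have h2 : X + 1 ≤ 2 * X := by linarith
    have h3 : (X * (X + 1)) ^ 2 ≤ (X * (2 * X)) ^ 2 :=
      pow_le_pow_left₀ (by positivity) (mul_le_mul_of_nonneg_left h2 hX0.le) 2
    nlinarith
  have hzne : z.natAbs ≠ 0 := Int.natAbs_ne_zero.mpr hz0
  have hW1 : (1 : ℝ) ≤ (wt5 z : ℝ) := by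
    have : 1 ≤ wt5 z := by
      unfold wt5
      rw [Nat.one_le_iff_ne_zero, Finset.prod_ne_zero_iff]
      intro q hq
      obtain ⟨hqp, hqd, hne⟩ := Nat.mem_primeFactors.mp (Finset.mem_filter.mp hq).1
      exact (hqp.factorization_pos_of_dvd hne hqd).ne'
    exact_mod_cast this
  have hWle : (wt5 z : ℝ) ≤ K * P ^ θ₁ := by
    have h1 : (wt5 z : ℝ) ≤ (z.natAbs.divisors.card : ℝ) := by exact_mod_cast wt5_le_card_divisors z hz0
    have h2 : (z.natAbs.divisors.card : ℝ) ≤ Cη * ((z.natAbs : ℕ) : ℝ) ^ η := hτ _ hzne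
    have h3 : ((z.natAbs : ℕ) : ℝ) ^ η ≤ (110592 * X ^ (4 : ℕ)) ^ η :=
      Real.rpow_le_rpow (by positivity) hzabs hη0.le
    have h6 : (110592 * X ^ (4 : ℕ)) ^ η = (110592 : ℝ) ^ η * P ^ θ₁ := by
      rw [Real.mul_rpow (by norm_num) (by positivity), hX, ← pow_mul, ← Real.rpow_natCast P (m * 4),
        ← Real.rpow_mul hP0.le, h4]
    calc (wt5 z : ℝ) ≤ Cη * ((z.natAbs : ℕ) : ℝ) ^ η := h1.trans h2
      _ ≤ Cη * (110592 * X ^ (4 : ℕ)) ^ η := mul_le_mul_of_nonneg_left h3 hCη0.le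
      _ = K * P ^ θ₁ := by rw [h6, hKdef]; ring
  -- the class condition at level `θ`
  have hthin : (wt5 z : ℝ) ≤ K * (rad5 z : ℝ) ^ θ := by
    calc (wt5 z : ℝ) ≤ K * P ^ θ₁ := hWle
      _ ≤ K * (rad5 z : ℝ) ^ θ₁ := mul_le_mul_of_nonneg_left (Real.rpow_le_rpow hP0.le hR_ge hθ₁0.le) hK0.le
      _ ≤ K * (rad5 z : ℝ) ^ θ := mul_le_mul_of_nonneg_left (Real.rpow_le_rpow_of_exponent_le hR1 hθ₁θ) hK0.le
  have key := hC (freyX b) (freyY b) hz0 h1728 hprim hcusp hcop (by simpa only [hzdef] using hthin)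
  have key' : ((max |z| (|freyX b| ^ 3) : ℤ) : ℝ) ≤ C * ((rad5 z : ℝ) * (wt5 z : ℝ)) ^ κ := by
    simpa only [hzdef] using key
  -- `rad5 · wt5 ≤ 2 K P^{m+1+θ₁}`
  have hRW1 : (1 : ℝ) ≤ (rad5 z : ℝ) * (wt5 z : ℝ) := one_le_mul_of_one_le_of_one_le hR1 hW1
  have hPe : P ^ m * P * P ^ θ₁ = P ^ ((m : ℝ) + 1 + θ₁) := by
    rw [Real.rpow_add hP0, Real.rpow_add hP0, Real.rpow_one, Real.rpow_natCast]
  have hRW : (rad5 z : ℝ) * (wt5 z : ℝ) ≤ 2 * K * P ^ ((m : ℝ) + 1 + θ₁) := by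
    calc (rad5 z : ℝ) * (wt5 z : ℝ) ≤ (2 * P * X) * (K * P ^ θ₁) :=
          mul_le_mul hR_le hWle (by positivity) (by positivity)
      _ = 2 * K * (P ^ m * P * P ^ θ₁) := by rw [hX]; ring
      _ = 2 * K * P ^ ((m : ℝ) + 1 + θ₁) := by rw [hPe]
  have h2K : (0 : ℝ) ≤ 2 * K := by positivity
  have hpow : ((rad5 z : ℝ) * (wt5 z : ℝ)) ^ κ ≤ (2 * K) ^ k * P ^ e := by
    calc ((rad5 z : ℝ) * (wt5 z : ℝ)) ^ κ ≤ ((rad5 z : ℝ) * (wt5 z : ℝ)) ^ k :=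
          Real.rpow_le_rpow_of_exponent_le hRW1 (le_max_left _ _)
      _ ≤ (2 * K * P ^ ((m : ℝ) + 1 + θ₁)) ^ k := Real.rpow_le_rpow (by positivity) hRW hk0
      _ = (2 * K) ^ k * (P ^ ((m : ℝ) + 1 + θ₁)) ^ k := Real.mul_rpow h2K (Real.rpow_nonneg hP0.le _)
      _ = (2 * K) ^ k * P ^ e := by rw [← Real.rpow_mul hP0.le, he]
  have hR : C * ((rad5 z : ℝ) * (wt5 z : ℝ)) ^ κ ≤ M * P ^ e := by
    calc C * ((rad5 z : ℝ) * (wt5 z : ℝ)) ^ κ ≤ max C 0 * ((rad5 z : ℝ) * (wt5 z : ℝ)) ^ κ :=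
          mul_le_mul_of_nonneg_right (le_max_left _ _) (Real.rpow_nonneg (by positivity) _)
      _ ≤ max C 0 * ((2 * K) ^ k * P ^ e) := mul_le_mul_of_nonneg_left hpow (le_max_right _ _)
      _ = M * P ^ e := by rw [hM]; ring
  -- `LHS ≥ |x_b|³ ≥ (16 X²)³ ≥ P^{6m}`
  have hL : P ^ (6 * m) ≤ ((max |z| (|freyX b| ^ 3) : ℤ) : ℝ) := by
    have hx : X ^ 2 ≤ ((freyX b : ℤ) : ℝ) := by
      have : ((freyX b : ℤ) : ℝ) = 16 * (1 + X + X ^ 2) := by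
        unfold freyX; push_cast; rw [hXb]
      rw [this]; nlinarith
    have hx0 : (0 : ℝ) ≤ ((freyX b : ℤ) : ℝ) := le_trans (by positivity) hx
    push_cast
    refine le_max_of_le_right ?_
    rw [abs_of_nonneg hx0]
    calc P ^ (6 * m) = (X ^ 2) ^ 3 := by rw [hX, ← pow_mul, ← pow_mul]; ring_nf
      _ ≤ ((freyX b : ℤ) : ℝ) ^ 3 := pow_le_pow_left₀ (by positivity) hx 3
  -- combine
  have hsplit : P ^ (6 * m) = P ^ g * P ^ e := by
    rw [← Real.rpow_natCast P (6 * m), ← Real.rpow_add hP0, hg]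
    push_cast; ring_nf
  have hPe0 : 0 < P ^ e := Real.rpow_pos_of_pos hP0 e
  have h1 : P ^ g * P ^ e ≤ M * P ^ e := by
    rw [← hsplit]
    exact hL.trans (key'.trans hR)
  have h3 : P ^ g ≤ M := le_of_mul_le_mul_right h1 hPe0
  linarith

end CuspTargets

end Summit.ABC.ABC.Cruxes.ThinWeightedSzpiro.Disproof
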